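import Mathlib
import Literature.Analysis.Convex.MonotoneOperatorResolvent
import Literature.Analysis.Convex.DouglasRachfordSplitting
import Literature.Analysis.Convex.KyFanInequality
import Literature.Analysis.Convex.FixedPointResidualRates
import HarnessLib

/-!
# The primal–dual hybrid gradient method (Chambolle–Pock) is a proximal point step in the metric
# `M = [[τ⁻¹ I, −K*], [−K, σ⁻¹ I]]` (He–Yuan 2012; Chambolle–Pock 2016, §3)

Topic `Literature/Analysis/Convex` (companion of `MonotoneOperatorResolvent.lean` — operators as
subsets of `H × H`, resolvents `J_{cT}`, resolvent MAPS `IsResolventMap c T j`, and the relaxed proximal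
point iteration `exists_tendsto_kmIter_resolvent`; and of `ProximalPointAlgorithm.lean`,
`DouglasRachfordSplitting.lean`, `ADMMConvergence.lean`). Namespace
`Literature.Analysis.Convex.PrimalDualHybridGradient`. Everything PROVED; no named facts.

Sources. A. Chambolle, T. Pock, *A first-order primal-dual algorithm for convex problems with
applications to imaging*, J. Math. Imaging Vision 40 (2011) 120–145 [ChambollePock2010] (held,
`paper:doi-10-1007-s10851-010-0251-1`, PDF p. 5: Algorithm 1 and Theorem 1); A. Chambolle, T. Pock,
*On the ergodic convergence rates of a first-order primal–dual algorithm*, Math. Program. 159 (2016)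
253–287 [ChambollePock2015] (held, `paper:doi-10-1007-s10107-015-0957-3`, PDF pp. 5–7: Algorithm 1,
(11), (12), Theorem 1); B. He, X. Yuan, *Convergence analysis of primal-dual algorithms for a
saddle-point problem: from contraction perspective*, SIAM J. Imaging Sci. 5 (2012) 119–149
[HeYuan2012] (not held; it is reference [16] of [ChambollePock2015], whose §3 restates its
proximal-point interpretation verbatim, quoted below).

THE PRINTED STATEMENTS. For the saddle-point problem `min_x max_y ⟨Kx, y⟩ + g(x) − h*(y)`
(`K : X → Y` bounded linear between real Hilbert spaces, `g`, `h*` proper convex lsc), the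
primal–dual algorithm with `θ = 1` ([ChambollePock2010, Algorithm 1, (7)]; written with the updates
"shifted" as [ChambollePock2015, Algorithm 1, (11)]: `(x^{n+1}, y^{n+1}) = PD_{τ,σ}(x^n, y^n, 2x^{n+1} − x^n, y^n)`)
reads
`x^{n+1} = (I + τ ∂g)⁻¹ (x^n − τ K* y^n)`, `y^{n+1} = (I + σ ∂h*)⁻¹ (y^n + σ K (2x^{n+1} − x^n))`.
[ChambollePock2015, §3, p. 5–6]: "The elegant interpretation in [16] shows that by writing the
algorithm in this form … in the Euclidean case … it is an instance of the proximal point algorithm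
[27], … since
`0 ∈ ( K* + ∂g ; −K + ∂h* ) (z^{n+1}) + M_{τ,σ} (z^{n+1} − z^n)`,   (12)
where the variable `z ∈ X × Y` represents the pair `(x, y)`, and the matrix `M_{τ,σ}` is given by
`M_{τ,σ} = [[ (1/τ) I, −K* ], [ −K, (1/σ) I ]]`, which is positive-definite as soon as `τσL² < 1`. A
proof of convergence is easily deduced." (`L = ‖K‖`.) [ChambollePock2010, Theorem 1]: "Let `L = ‖K‖`
and assume problem (2) has a saddle-point `(x̂, ŷ)`. Choose `θ = 1`, `τσL² < 1` … (c) If the dimension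
of the spaces `X` and `Y` is finite, then there exists a saddle-point `(x*, y*)` such that `x^n → x*`
and `y^n → y*`."

WHAT IS TYPED HERE (the subdifferentials `∂g`, `∂h*` are replaced by arbitrary monotone operators
`A ⊂ X × X`, `B ⊂ Y × Y` given with resolvent maps `jA = J_{τA}`, `jB = J_{σB}` — for the conic
programs of semidefinite bootstraps these are metric projections onto closed convex cones; the
pair `z = (x, y)` lives in the Hilbert space `WithLp 2 (X × Y)`):

* `pdhgStep K τ σ jA jB` — one iteration (11) with `θ = 1`.
* `kkt K A B` — the KKT operator `F(x, y) = (Ax + K* y) × (By − Kx)` of (12) on `WithLp 2 (X × Y)`;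
  `isMonotone_kkt` — it is monotone when `A`, `B` are (the bilinear coupling is skew);
  `mem_zer_kkt_iff` — its zeros are the KKT (saddle) points: `−K* y ∈ Ax`, `Kx ∈ By`.
* `metricM K τ σ` — the map `M_{τ,σ}`; `inner_metricM_comm` (symmetry) and
  **`inner_metricM_self_ge`**: `⟨z, M z⟩ ≥ (1 − √(τσ)‖K‖) (‖x‖²/τ + ‖y‖²/σ)`, so `M_{τ,σ}` is positive
  definite as soon as `τσ‖K‖² < 1` (`inner_metricM_self_pos`).
* **`pdhgStep_mem_kkt`** — identity (12): for `z⁺ = pdhgStep z`, `(z⁺, M_{τ,σ}(z − z⁺)) ∈ F`, i.e.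
  `0 ∈ F(z⁺) + M_{τ,σ}(z⁺ − z)` — ONE PDHG STEP IS ONE PROXIMAL POINT STEP FOR `F` IN THE METRIC `M`.
* `pdhgStep_eq_self_iff` — fixed points of the iteration are exactly the zeros of `F` (saddle points).
* `fejer_step` — the Fejér inequality in the metric `M`: `‖z⁺ − z*‖²_M + ‖z − z⁺‖²_M ≤ ‖z − z*‖²_M`
  for every saddle point `z*`; **`tendsto_pdhgIter`** = [ChambollePock2010, Thm 1 (c)]: in finite
  dimension, for `τ, σ > 0`, `τσ‖K‖² < 1` and a saddle point existing, the iterates `pdhgIter`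
  CONVERGE to a saddle point (bounded ⇒ cluster point; steps → 0 + continuity ⇒ it is a fixed point;
  Fejér ⇒ the whole sequence converges), `continuous_pdhgStep`.

* Section `Conic`: `shiftOp` (`c + T`, resolvent `z ↦ J_{γT}(z − γc)`), `mem_zer_kkt_conic_iff` and
  **`tendsto_pdhgIter_conic`** — the projection form `x⁺ = P_C(x − τ(K*y + c))`,
  `y⁺ = P_D(y + σ(K(2x⁺ − x) − b))` for the constrained bilinear saddle `⟨c,x⟩ + ⟨Kx,y⟩ − ⟨b,y⟩` on
  closed convex `C × D` (the PDLP-type conic kernel) converges to a saddle point (resolvents of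
  normal cones are projections: `DouglasRachford.isResolventMap_proj`).

* `conicL`, `conicL_step_le`, `xAvg`/`yAvg`, **`conicL_gap_ergodic_le`** = [ChambollePock2015, Thm 1]
  in the constrained bilinear case (`f = 0`, Euclidean distances): for `τσ‖K‖² ≤ 1` and every
  `(x, y) ∈ C × D`, `L(X_N, y) − L(x, Y_N) ≤ ‖z⁰ − (x, y)‖²_M / (2N)` — the ergodic `O(1/N)` rate of the
  primal–dual gap along the averaged iterates.

* `mem_zer_kkt_conic_iff_saddle` (KKT zeros = saddle points of `L` on `C × D`),
  **`zer_kkt_conic_nonempty_of_isCompact`** (a saddle point EXISTS for nonempty compact convex `C`, `D`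
  — von Neumann's theorem, from the tree's `KyFanInequality.exists_isSaddlePoint` [Aubin1993, Thm 8.2]),
  `conicL_gap_ergodic_saddle` (`0 ≤ L(X_N, y*) − L(x*, Y_N) ≤ ‖z⁰ − z*‖²_M/(2N)`,
  [ChambollePock2015, Remark 3]) and **`tendsto_pdhgIter_conic_of_isCompact`** (compact `C`, `D`,
  finite dimension, `τσ‖K‖² < 1` ⇒ convergence to a saddle point, no existence hypothesis).

* `mem_zer_kkt_conic_of_tendsto_avg` (subsequential limits of the averaged iterates are saddle
  points, [ChambollePock2015, Remark 3]), `exists_tendsto_avg_subseq_of_isCompact`, and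
  `tendsto_avg_of_tendsto` (if `z^n → z̄` then `(X_N, Y_N) → z̄`, Cesàro).

* Section `Residual`: `inner_metricM_self_nonneg` (`M ⪰ 0` for `τσ‖K‖² ≤ 1`), `residual_antitone`
  (`‖z^{k+1} − z^{k+2}‖²_M ≤ ‖z^k − z^{k+1}‖²_M`), `sum_residual_le`, **`residual_le_div`**
  (`‖z^N − z^{N+1}‖²_M ≤ ‖z⁰ − z*‖²_M/(N+1)`) = [DavisYin2016, Thm 1 (2)–(4)] for the PPA form (12),
  and `tendsto_mul_residual` (`k · ‖z^k − z^{k+1}‖²_M → 0`, the little-`o` clause, via the tree's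
  `FixedPointResidualRates.tendsto_window_mul`).

Deliberately NOT here: the general `f ≠ 0` / Bregman form of [ChambollePock2015, Thm 1] and the constant
`C ≤ (1 − τσL²)⁻¹` of [ChambollePock2010, Thm 1 (a)]; infinite-dimensional weak convergence
[Thm 1 (b)]; over-relaxation, inertial and accelerated variants; `θ ≠ 1`; restarts.
-/

namespace Literature.Analysis.Convex.PrimalDualHybridGradient

open scoped RealInnerProductSpace
open Literature.Analysis.Convex.MonotoneOperator (IsMonotone resolvent IsResolventMap zer
  mem_resolvent_iff mem_zer_iff)

variable {X Y : Type*} [NormedAddCommGroup X] [InnerProductSpace ℝ X] [CompleteSpace X]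
  [NormedAddCommGroup Y] [InnerProductSpace ℝ Y] [CompleteSpace Y]

/-! ### The iteration -/

/-- **One step of the primal–dual hybrid gradient method** (Chambolle–Pock, `θ = 1`, in the shifted
form (11)): `x⁺ = J_{τA}(x − τ K* y)`, `y⁺ = J_{σB}(y + σ K (2x⁺ − x))`, where `jA = J_{τA}`,
`jB = J_{σB}` are the resolvent (proximal) maps of the two monotone operators.
[cite: ChambollePock2015, §3 Algorithm 1, (11)] [cite: ChambollePock2010, Algorithm 1, (7) (θ = 1)] -/
noncomputable def pdhgStep (K : X →L[ℝ] Y) (τ σ : ℝ) (jA : X → X) (jB : Y → Y) (u : X × Y) :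
    X × Y :=
  (jA (u.1 - τ • K.adjoint u.2),
    jB (u.2 + σ • K ((2 : ℝ) • jA (u.1 - τ • K.adjoint u.2) - u.1)))

omit [CompleteSpace X] [CompleteSpace Y] in
/-- The primal update of `pdhgStep`. [cite: ChambollePock2015, §3 (11)] -/
theorem pdhgStep_fst [CompleteSpace X] [CompleteSpace Y] (K : X →L[ℝ] Y) (τ σ : ℝ) (jA : X → X)
    (jB : Y → Y) (u : X × Y) : (pdhgStep K τ σ jA jB u).1 = jA (u.1 - τ • K.adjoint u.2) := rfl

omit [CompleteSpace X] [CompleteSpace Y] in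
/-- The dual update of `pdhgStep` (uses the extrapolated point `2x⁺ − x`).
[cite: ChambollePock2015, §3 (11)] -/
theorem pdhgStep_snd [CompleteSpace X] [CompleteSpace Y] (K : X →L[ℝ] Y) (τ σ : ℝ) (jA : X → X)
    (jB : Y → Y) (u : X × Y) :
    (pdhgStep K τ σ jA jB u).2 =
      jB (u.2 + σ • K ((2 : ℝ) • (pdhgStep K τ σ jA jB u).1 - u.1)) := rfl

/-! ### The KKT operator and the metric -/

/-- **The KKT operator** of the saddle-point problem, `F(x, y) = (Ax + K* y) × (By − Kx)`, as an
operator (subset of `H × H`) on the Hilbert space `H = WithLp 2 (X × Y)` of pairs `z = (x, y)`: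
the operator `( K* + ∂g ; −K + ∂h* )` of (12) with `∂g`, `∂h*` generalised to monotone `A`, `B`.
[cite: ChambollePock2015, §3 (12)] -/
def kkt (K : X →L[ℝ] Y) (A : Set (X × X)) (B : Set (Y × Y)) :
    Set (WithLp 2 (X × Y) × WithLp 2 (X × Y)) :=
  {p | ∃ a b, (p.1.fst, a) ∈ A ∧ (p.1.snd, b) ∈ B ∧
    p.2.fst = a + K.adjoint p.1.snd ∧ p.2.snd = b - K p.1.fst}

/-- Membership in the KKT operator, unfolded. [cite: ChambollePock2015, §3 (12)] -/
theorem mem_kkt_iff {K : X →L[ℝ] Y} {A : Set (X × X)} {B : Set (Y × Y)}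
    {z w : WithLp 2 (X × Y)} :
    (z, w) ∈ kkt K A B ↔ ∃ a b, (z.fst, a) ∈ A ∧ (z.snd, b) ∈ B ∧
      w.fst = a + K.adjoint z.snd ∧ w.snd = b - K z.fst := Iff.rfl

/-- **The zeros of the KKT operator are the saddle (KKT) points**: `0 ∈ F(x, y)` iff
`−K* y ∈ Ax` and `Kx ∈ By` (for `A = ∂g`, `B = ∂h*` these are the optimality conditions of the
saddle-point problem (2)). [cite: ChambollePock2010, §2 (2) and §3.1 (saddle point)] -/
theorem mem_zer_kkt_iff {K : X →L[ℝ] Y} {A : Set (X × X)} {B : Set (Y × Y)}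
    {z : WithLp 2 (X × Y)} :
    z ∈ zer (kkt K A B) ↔ (z.fst, -K.adjoint z.snd) ∈ A ∧ (z.snd, K z.fst) ∈ B := by
  rw [mem_zer_iff, mem_kkt_iff]
  constructor
  · rintro ⟨a, b, ha, hb, h1, h2⟩
    have ha' : a = -K.adjoint z.snd := by
      have : (0 : WithLp 2 (X × Y)).fst = 0 := rfl
      rw [this] at h1
      exact eq_neg_of_add_eq_zero_left h1.symm
    have hb' : b = K z.fst := by
      have : (0 : WithLp 2 (X × Y)).snd = 0 := rfl
      rw [this] at h2
      exact (sub_eq_zero.mp h2.symm)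
    exact ⟨ha' ▸ ha, hb' ▸ hb⟩
  · rintro ⟨ha, hb⟩
    refine ⟨-K.adjoint z.snd, K z.fst, ha, hb, ?_, ?_⟩
    · show (0 : X) = _; simp
    · show (0 : Y) = _; simp

/-- **The KKT operator is monotone** when `A` and `B` are: the coupling `(K* y, −K x)` is skew, so
`⟨z′ − z, F z′ − F z⟩ = ⟨x′ − x, a′ − a⟩ + ⟨y′ − y, b′ − b⟩ ≥ 0` ("we never really use the machinery of
monotone operators" — but this is the fact that makes (12) a proximal point step).
[cite: ChambollePock2015, §3 (12)] [cite: HeYuan2012, §2] -/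
theorem isMonotone_kkt (K : X →L[ℝ] Y) {A : Set (X × X)} {B : Set (Y × Y)} (hA : IsMonotone A)
    (hB : IsMonotone B) : IsMonotone (kkt K A B) := by
  intro z w hzw z' w' hzw'
  obtain ⟨a, b, ha, hb, h1, h2⟩ := hzw
  obtain ⟨a', b', ha', hb', h1', h2'⟩ := hzw'
  have hAm : 0 ≤ ⟪z'.fst - z.fst, a' - a⟫ := hA ha ha'
  have hBm : 0 ≤ ⟪z'.snd - z.snd, b' - b⟫ := hB hb hb'
  rw [WithLp.prod_inner_apply]
  simp only [WithLp.ofLp_fst, WithLp.ofLp_snd, WithLp.sub_fst, WithLp.sub_snd]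
  have h1e : w.fst = a + K.adjoint z.snd := h1
  have h1e' : w'.fst = a' + K.adjoint z'.snd := h1'
  have h2e : w.snd = b - K z.fst := h2
  have h2e' : w'.snd = b' - K z'.fst := h2'
  rw [h1e, h1e', h2e, h2e']
  have e1 : a' + K.adjoint z'.snd - (a + K.adjoint z.snd) =
      (a' - a) + K.adjoint (z'.snd - z.snd) := by
    rw [map_sub]; abel
  have e2 : b' - K z'.fst - (b - K z.fst) = (b' - b) - K (z'.fst - z.fst) := by
    rw [map_sub]; abel
  have e3 : ⟪z'.fst - z.fst, (a' - a) + K.adjoint (z'.snd - z.snd)⟫ +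
      ⟪z'.snd - z.snd, (b' - b) - K (z'.fst - z.fst)⟫ =
      ⟪z'.fst - z.fst, a' - a⟫ + ⟪z'.snd - z.snd, b' - b⟫ := by
    have e4 : ⟪z'.snd - z.snd, (b' - b) - K (z'.fst - z.fst)⟫ =
        ⟪z'.snd - z.snd, b' - b⟫ - ⟪z'.snd - z.snd, K (z'.fst - z.fst)⟫ := inner_sub_right _ _ _
    have e5 : ⟪z'.fst - z.fst, (a' - a) + K.adjoint (z'.snd - z.snd)⟫ =
        ⟪z'.fst - z.fst, a' - a⟫ + ⟪K (z'.fst - z.fst), z'.snd - z.snd⟫ := by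
      rw [inner_add_right, ContinuousLinearMap.adjoint_inner_right]
    rw [e5, e4, real_inner_comm (K (z'.fst - z.fst)) (z'.snd - z.snd)]
    ring
  rw [e1, e2, e3]
  linarith

/-- **The metric of the proximal-point interpretation**, `M_{τ,σ} (x, y) = (x/τ − K* y, y/σ − K x)`
— the block operator `[[τ⁻¹ I, −K*], [−K, σ⁻¹ I]]` of (12). [cite: ChambollePock2015, §3 (12)]
[cite: HeYuan2012, §2] -/
noncomputable def metricM (K : X →L[ℝ] Y) (τ σ : ℝ) (d : WithLp 2 (X × Y)) : WithLp 2 (X × Y) :=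
  WithLp.toLp 2 (τ⁻¹ • d.fst - K.adjoint d.snd, σ⁻¹ • d.snd - K d.fst)

/-- Components of `M_{τ,σ} d`. [cite: ChambollePock2015, §3 (12)] -/
theorem metricM_fst (K : X →L[ℝ] Y) (τ σ : ℝ) (d : WithLp 2 (X × Y)) :
    (metricM K τ σ d).fst = τ⁻¹ • d.fst - K.adjoint d.snd := rfl

/-- Components of `M_{τ,σ} d`. [cite: ChambollePock2015, §3 (12)] -/
theorem metricM_snd (K : X →L[ℝ] Y) (τ σ : ℝ) (d : WithLp 2 (X × Y)) :
    (metricM K τ σ d).snd = σ⁻¹ • d.snd - K d.fst := rfl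

/-- The quadratic form of the metric:
`⟨d, M_{τ,σ} d⟩ = ‖d_x‖²/τ − 2⟨K d_x, d_y⟩ + ‖d_y‖²/σ`. [cite: ChambollePock2015, §3 (12)] -/
theorem inner_metricM_self (K : X →L[ℝ] Y) (τ σ : ℝ) (d : WithLp 2 (X × Y)) :
    ⟪d, metricM K τ σ d⟫ = τ⁻¹ * ‖d.fst‖ ^ 2 - 2 * ⟪K d.fst, d.snd⟫ + σ⁻¹ * ‖d.snd‖ ^ 2 := by
  rw [WithLp.prod_inner_apply]
  simp only [WithLp.ofLp_fst, WithLp.ofLp_snd, metricM_fst, metricM_snd]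
  rw [inner_sub_right, inner_sub_right, inner_smul_right, inner_smul_right,
    real_inner_self_eq_norm_sq, real_inner_self_eq_norm_sq, ContinuousLinearMap.adjoint_inner_right,
    real_inner_comm (K d.fst)]
  ring

/-- `M_{τ,σ}` is symmetric: `⟨d, M d′⟩ = ⟨M d, d′⟩`. [cite: ChambollePock2015, §3 (12)] -/
theorem inner_metricM_comm (K : X →L[ℝ] Y) (τ σ : ℝ) (d d' : WithLp 2 (X × Y)) :
    ⟪d, metricM K τ σ d'⟫ = ⟪metricM K τ σ d, d'⟫ := by
  rw [WithLp.prod_inner_apply, WithLp.prod_inner_apply]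
  simp only [WithLp.ofLp_fst, WithLp.ofLp_snd, metricM_fst, metricM_snd]
  rw [inner_sub_right, inner_sub_right, inner_smul_right, inner_smul_right, inner_sub_left,
    inner_sub_left, inner_smul_left, inner_smul_left, ContinuousLinearMap.adjoint_inner_right,
    ContinuousLinearMap.adjoint_inner_left]
  simp only [conj_trivial]
  ring

/-- **`M_{τ,σ}` is positive definite as soon as `τσ‖K‖² < 1`**, quantitatively: for `τ, σ > 0`,
`⟨d, M_{τ,σ} d⟩ ≥ (1 − √(τσ)·‖K‖) · (‖d_x‖²/τ + ‖d_y‖²/σ)` (Cauchy–Schwarz on the coupling term and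
`2ab ≤ a²/τ·√(τσ) … `, the estimate behind "which is positive-definite as soon as `τσL² < 1`").
[cite: ChambollePock2015, §3 (after (12))] [cite: ChambollePock2010, Theorem 1 (hypothesis τσL² < 1)] -/
theorem inner_metricM_self_ge (K : X →L[ℝ] Y) {τ σ : ℝ} (hτ : 0 < τ) (hσ : 0 < σ)
    (d : WithLp 2 (X × Y)) :
    (1 - Real.sqrt (τ * σ) * ‖K‖) * (τ⁻¹ * ‖d.fst‖ ^ 2 + σ⁻¹ * ‖d.snd‖ ^ 2) ≤
      ⟪d, metricM K τ σ d⟫ := by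
  rw [inner_metricM_self]
  -- the coupling term: `2⟨K d_x, d_y⟩ ≤ √(τσ)‖K‖ (‖d_x‖²/τ + ‖d_y‖²/σ)`
  have hK : |⟪K d.fst, d.snd⟫| ≤ ‖K‖ * ‖d.fst‖ * ‖d.snd‖ := by
    calc |⟪K d.fst, d.snd⟫| ≤ ‖K d.fst‖ * ‖d.snd‖ := abs_real_inner_le_norm _ _
      _ ≤ ‖K‖ * ‖d.fst‖ * ‖d.snd‖ :=
          mul_le_mul_of_nonneg_right (K.le_opNorm _) (norm_nonneg _)
  -- AM–GM with the weights `τ`, `σ`: `2 ‖d_x‖ ‖d_y‖ ≤ √(τσ) (‖d_x‖²/τ + ‖d_y‖²/σ)`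
  have hst : Real.sqrt (τ * σ) ^ 2 = τ * σ := Real.sq_sqrt (by positivity)
  have hs0 : 0 < Real.sqrt (τ * σ) := Real.sqrt_pos.mpr (by positivity)
  have hamgm : 2 * (‖d.fst‖ * ‖d.snd‖) ≤
      Real.sqrt (τ * σ) * (τ⁻¹ * ‖d.fst‖ ^ 2 + σ⁻¹ * ‖d.snd‖ ^ 2) := by
    -- `(σ^{1/2} τ^{-1/2} a − τ^{1/2} σ^{-1/2} b)² ≥ 0`, written without roots of `τ`, `σ` separately:
    -- multiply through by `√(τσ) > 0`: `2√(τσ) a b ≤ σ a² + τ b²`, i.e. `(√(τσ))² … `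
    have key : 2 * Real.sqrt (τ * σ) * (‖d.fst‖ * ‖d.snd‖) ≤ σ * ‖d.fst‖ ^ 2 + τ * ‖d.snd‖ ^ 2 := by
      nlinarith [sq_nonneg (Real.sqrt (τ * σ) * ‖d.snd‖ - σ * ‖d.fst‖),
        sq_nonneg (Real.sqrt (τ * σ) * ‖d.fst‖ - τ * ‖d.snd‖), hst, norm_nonneg d.fst,
        norm_nonneg d.snd, hτ, hσ]
    have e : Real.sqrt (τ * σ) * (τ⁻¹ * ‖d.fst‖ ^ 2 + σ⁻¹ * ‖d.snd‖ ^ 2) =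
        (σ * ‖d.fst‖ ^ 2 + τ * ‖d.snd‖ ^ 2) / Real.sqrt (τ * σ) := by
      rw [eq_div_iff hs0.ne']
      have : Real.sqrt (τ * σ) * (τ⁻¹ * ‖d.fst‖ ^ 2 + σ⁻¹ * ‖d.snd‖ ^ 2) * Real.sqrt (τ * σ) =
          Real.sqrt (τ * σ) ^ 2 * (τ⁻¹ * ‖d.fst‖ ^ 2 + σ⁻¹ * ‖d.snd‖ ^ 2) := by ring
      rw [this, hst]
      field_simp
    rw [e, le_div_iff₀ hs0]
    linarith
  have h2 : 2 * ⟪K d.fst, d.snd⟫ ≤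
      Real.sqrt (τ * σ) * ‖K‖ * (τ⁻¹ * ‖d.fst‖ ^ 2 + σ⁻¹ * ‖d.snd‖ ^ 2) := by
    have h3 : 2 * ⟪K d.fst, d.snd⟫ ≤ 2 * (‖K‖ * ‖d.fst‖ * ‖d.snd‖) := by
      linarith [(abs_le.mp hK).2]
    have h4 : 2 * (‖K‖ * ‖d.fst‖ * ‖d.snd‖) = ‖K‖ * (2 * (‖d.fst‖ * ‖d.snd‖)) := by ring
    have h5 : ‖K‖ * (2 * (‖d.fst‖ * ‖d.snd‖)) ≤
        ‖K‖ * (Real.sqrt (τ * σ) * (τ⁻¹ * ‖d.fst‖ ^ 2 + σ⁻¹ * ‖d.snd‖ ^ 2)) :=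
      mul_le_mul_of_nonneg_left hamgm (norm_nonneg _)
    linarith
  nlinarith

/-- Hence for `τσ‖K‖² < 1` the form is coercive: `⟨d, M_{τ,σ} d⟩ > 0` for `d ≠ 0`
("positive-definite as soon as `τσL² < 1`"). [cite: ChambollePock2015, §3 (after (12))] -/
theorem inner_metricM_self_pos (K : X →L[ℝ] Y) {τ σ : ℝ} (hτ : 0 < τ) (hσ : 0 < σ)
    (hK : τ * σ * ‖K‖ ^ 2 < 1) {d : WithLp 2 (X × Y)} (hd : d ≠ 0) :
    0 < ⟪d, metricM K τ σ d⟫ := by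
  have hcoef : 0 < 1 - Real.sqrt (τ * σ) * ‖K‖ := by
    have h0 : 0 ≤ Real.sqrt (τ * σ) * ‖K‖ := by positivity
    have h1 : (Real.sqrt (τ * σ) * ‖K‖) ^ 2 < 1 := by
      rw [mul_pow, Real.sq_sqrt (by positivity)]; exact hK
    nlinarith
  have hpos : 0 < τ⁻¹ * ‖d.fst‖ ^ 2 + σ⁻¹ * ‖d.snd‖ ^ 2 := by
    have : d.fst ≠ 0 ∨ d.snd ≠ 0 := by
      by_contra h
      push Not at h
      apply hd
      have : WithLp.ofLp d = 0 := Prod.ext h.1 h.2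
      calc d = WithLp.toLp 2 (WithLp.ofLp d) := rfl
        _ = 0 := by rw [this]; rfl
    rcases this with h | h
    · have := norm_pos_iff.mpr h
      positivity
    · have := norm_pos_iff.mpr h
      positivity
  exact lt_of_lt_of_le (mul_pos hcoef hpos) (inner_metricM_self_ge K hτ hσ d)

/-! ### One PDHG step is one proximal point step for `F` in the metric `M` -/

/-- **He–Yuan's identity (12): `0 ∈ F(z⁺) + M_{τ,σ}(z⁺ − z)`.** For `z = (x, y)` and
`z⁺ = (x⁺, y⁺) = pdhgStep z` (resolvent maps `jA = J_{τA}`, `jB = J_{σB}`, `τ, σ ≠ 0`), the pair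
`(z⁺, M_{τ,σ}(z − z⁺))` lies in the KKT operator `F = (A + K*·) × (B − K·)`: with `a := (x − x⁺)/τ − K* y
∈ A x⁺` and `b := (y − y⁺)/σ + K(2x⁺ − x) ∈ B y⁺` (the resolvent equations), `a + K* y⁺ = (x − x⁺)/τ −
K*(y − y⁺)` and `b − K x⁺ = (y − y⁺)/σ − K(x − x⁺)`. "It is an instance of the proximal point algorithm."
[cite: ChambollePock2015, §3 (12)] [cite: HeYuan2012, §2 (PPA interpretation)] -/
theorem pdhgStep_mem_kkt (K : X →L[ℝ] Y) {A : Set (X × X)} {B : Set (Y × Y)} {τ σ : ℝ}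
    (hτ : τ ≠ 0) (hσ : σ ≠ 0) {jA : X → X} {jB : Y → Y} (hjA : IsResolventMap τ A jA)
    (hjB : IsResolventMap σ B jB) (u : X × Y) :
    (WithLp.toLp 2 (pdhgStep K τ σ jA jB u),
      metricM K τ σ (WithLp.toLp 2 u - WithLp.toLp 2 (pdhgStep K τ σ jA jB u))) ∈ kkt K A B := by
  set x' := (pdhgStep K τ σ jA jB u).1 with hx'
  set y' := (pdhgStep K τ σ jA jB u).2 with hy'
  -- the two resolvent equations
  obtain ⟨a, ha, hax⟩ := (mem_resolvent_iff).mp (hjA (u.1 - τ • K.adjoint u.2))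
  obtain ⟨b, hb, hby⟩ := (mem_resolvent_iff).mp (hjB (u.2 + σ • K ((2 : ℝ) • x' - u.1)))
  have hxeq : jA (u.1 - τ • K.adjoint u.2) = x' := rfl
  have hyeq : jB (u.2 + σ • K ((2 : ℝ) • x' - u.1)) = y' := rfl
  rw [hxeq] at ha hax
  rw [hyeq] at hb hby
  refine (mem_kkt_iff).mpr ⟨a, b, ?_, ?_, ?_, ?_⟩
  · simpa using ha
  · simpa using hb
  · -- first component: `τ⁻¹ (x − x⁺) − K*(y − y⁺) = a + K* y⁺`
    show τ⁻¹ • (WithLp.toLp 2 u - WithLp.toLp 2 (x', y')).fst -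
        K.adjoint (WithLp.toLp 2 u - WithLp.toLp 2 (x', y')).snd = a + K.adjoint y'
    simp only [WithLp.sub_fst, WithLp.sub_snd, WithLp.toLp_fst, WithLp.toLp_snd, map_sub]
    -- from `x⁺ + τ a = x − τ K* y`: `τ⁻¹ (x − x⁺) = a + K* y`
    have h1 : τ⁻¹ • (u.1 - x') = a + K.adjoint u.2 := by
      have : u.1 - x' = τ • (a + K.adjoint u.2) := by
        rw [smul_add]
        have := hax
        -- `x' + τ • a = u.1 - τ • K† u.2`
        calc u.1 - x' = (x' + τ • a) + τ • K.adjoint u.2 - x' := by rw [this]; abel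
          _ = τ • a + τ • K.adjoint u.2 := by abel
      rw [this, smul_smul, inv_mul_cancel₀ hτ, one_smul]
    rw [h1]
    abel
  · -- second component: `σ⁻¹ (y − y⁺) − K(x − x⁺) = b − K x⁺`
    show σ⁻¹ • (WithLp.toLp 2 u - WithLp.toLp 2 (x', y')).snd -
        K (WithLp.toLp 2 u - WithLp.toLp 2 (x', y')).fst = b - K x'
    simp only [WithLp.sub_fst, WithLp.sub_snd, WithLp.toLp_fst, WithLp.toLp_snd, map_sub]
    have h1 : σ⁻¹ • (u.2 - y') = b - K ((2 : ℝ) • x' - u.1) := by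
      have : u.2 - y' = σ • (b - K ((2 : ℝ) • x' - u.1)) := by
        rw [smul_sub]
        calc u.2 - y' = (y' + σ • b) - σ • K ((2 : ℝ) • x' - u.1) - y' := by rw [hby]; abel
          _ = σ • b - σ • K ((2 : ℝ) • x' - u.1) := by abel
      rw [this, smul_smul, inv_mul_cancel₀ hσ, one_smul]
    rw [h1, map_sub, map_smul, two_smul]
    abel

/-- **Fixed points of PDHG are exactly the saddle points** (zeros of the KKT operator): for
monotone `A`, `B` with resolvent maps `jA = J_{τA}`, `jB = J_{σB}` (`τ, σ > 0`),
`pdhgStep z = z ↔ 0 ∈ F(z)`. (`⇒` is (12) with `z⁺ = z`; `⇐` is uniqueness of resolvents of monotone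
operators.) [cite: ChambollePock2010, Theorem 1 (the limit is a saddle point)] [cite: ChambollePock2015, §3 (12)] -/
theorem pdhgStep_eq_self_iff (K : X →L[ℝ] Y) {A : Set (X × X)} {B : Set (Y × Y)} {τ σ : ℝ}
    (hτ : 0 < τ) (hσ : 0 < σ) (hA : IsMonotone A) (hB : IsMonotone B) {jA : X → X} {jB : Y → Y}
    (hjA : IsResolventMap τ A jA) (hjB : IsResolventMap σ B jB) (u : X × Y) :
    pdhgStep K τ σ jA jB u = u ↔ WithLp.toLp 2 u ∈ zer (kkt K A B) := by
  constructor
  · intro hfix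
    have h := pdhgStep_mem_kkt K hτ.ne' hσ.ne' hjA hjB u
    rw [hfix, sub_self] at h
    have hM0 : metricM K τ σ (0 : WithLp 2 (X × Y)) = 0 := by
      unfold metricM
      simp only [WithLp.zero_fst, WithLp.zero_snd, smul_zero, map_zero, sub_zero]
      rfl
    rw [hM0] at h
    exact (mem_zer_iff).mpr h
  · intro hz
    obtain ⟨ha, hb⟩ := (mem_zer_kkt_iff).mp hz
    simp only [WithLp.toLp_fst, WithLp.toLp_snd] at ha hb
    -- `x = J_{τA}(x − τ K* y)` since `−K* y ∈ A x`
    have hx : jA (u.1 - τ • K.adjoint u.2) = u.1 := by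
      apply hjA.apply_eq hA hτ
      exact (mem_resolvent_iff).mpr ⟨-K.adjoint u.2, ha, by rw [smul_neg]; abel⟩
    have hy : jB (u.2 + σ • K ((2 : ℝ) • u.1 - u.1)) = u.2 := by
      apply hjB.apply_eq hB hσ
      refine (mem_resolvent_iff).mpr ⟨K u.1, hb, ?_⟩
      rw [two_smul, add_sub_cancel_right]
    ext
    · exact hx
    · show jB (u.2 + σ • K ((2 : ℝ) • jA (u.1 - τ • K.adjoint u.2) - u.1)) = u.2
      rw [hx]; exact hy

/-! ### Convergence (Chambolle–Pock 2011, Theorem 1 (c)): in finite dimension the iterates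
converge to a saddle point -/

section Convergence

/-- `M_{τ,σ}` is additive-subtractive (it is linear): `M(d − d′) = M d − M d′`.
[cite: ChambollePock2015, §3 (12)] -/
theorem metricM_sub (K : X →L[ℝ] Y) (τ σ : ℝ) (d d' : WithLp 2 (X × Y)) :
    metricM K τ σ (d - d') = metricM K τ σ d - metricM K τ σ d' := by
  unfold metricM
  have h1 : (WithLp.toLp 2 (τ⁻¹ • d.fst - K.adjoint d.snd, σ⁻¹ • d.snd - K d.fst) -
      WithLp.toLp 2 (τ⁻¹ • d'.fst - K.adjoint d'.snd, σ⁻¹ • d'.snd - K d'.fst) : WithLp 2 (X × Y)) =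
      WithLp.toLp 2 ((τ⁻¹ • d.fst - K.adjoint d.snd) - (τ⁻¹ • d'.fst - K.adjoint d'.snd),
        (σ⁻¹ • d.snd - K d.fst) - (σ⁻¹ • d'.snd - K d'.fst)) := rfl
  rw [h1, WithLp.sub_fst, WithLp.sub_snd, map_sub, map_sub, smul_sub, smul_sub]
  congr 1
  ext <;> simp only <;> abel

/-- The quadratic form `q(d) = ⟨d, M_{τ,σ} d⟩` expands on a sum: `q(u + v) = q(u) + 2⟨u, M v⟩ + q(v)`
(symmetry of `M`). [cite: ChambollePock2015, §3 (12)] -/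
theorem inner_metricM_self_add (K : X →L[ℝ] Y) (τ σ : ℝ) (u v : WithLp 2 (X × Y)) :
    ⟪u + v, metricM K τ σ (u + v)⟫ =
      ⟪u, metricM K τ σ u⟫ + 2 * ⟪u, metricM K τ σ v⟫ + ⟪v, metricM K τ σ v⟫ := by
  have hadd : metricM K τ σ (u + v) = metricM K τ σ u + metricM K τ σ v := by
    have := metricM_sub K τ σ (u + v) v
    rw [add_sub_cancel_right] at this
    rw [eq_sub_iff_add_eq] at this
    exact this.symm
  have hsym : ⟪v, metricM K τ σ u⟫ = ⟪u, metricM K τ σ v⟫ := by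
    rw [inner_metricM_comm K τ σ u v]
    exact real_inner_comm _ _
  rw [hadd, inner_add_left, inner_add_right, inner_add_right, hsym]
  ring

/-- **The Fejér inequality of the proximal-point interpretation.** If `z*` is a saddle point (a zero
of `F`) and `z⁺ = pdhgStep z`, then in the metric `M = M_{τ,σ}`:
`‖z⁺ − z*‖²_M + ‖z − z⁺‖²_M ≤ ‖z − z*‖²_M` (monotonicity of `F` at the two pairs `(z⁺, M(z − z⁺))`,
`(z*, 0)` and the symmetry of `M`; [ChambollePock2010, Thm 1 (a)] is the summed form).
[cite: ChambollePock2010, Theorem 1 (a) (proof)] [cite: ChambollePock2015, §3 (12)] -/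
theorem fejer_step (K : X →L[ℝ] Y) {A : Set (X × X)} {B : Set (Y × Y)} {τ σ : ℝ} (hτ : 0 < τ)
    (hσ : 0 < σ) (hA : IsMonotone A) (hB : IsMonotone B) {jA : X → X} {jB : Y → Y}
    (hjA : IsResolventMap τ A jA) (hjB : IsResolventMap σ B jB) {zs : WithLp 2 (X × Y)}
    (hzs : zs ∈ zer (kkt K A B)) (u : X × Y) :
    ⟪WithLp.toLp 2 (pdhgStep K τ σ jA jB u) - zs,
        metricM K τ σ (WithLp.toLp 2 (pdhgStep K τ σ jA jB u) - zs)⟫ +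
      ⟪WithLp.toLp 2 u - WithLp.toLp 2 (pdhgStep K τ σ jA jB u),
        metricM K τ σ (WithLp.toLp 2 u - WithLp.toLp 2 (pdhgStep K τ σ jA jB u))⟫ ≤
      ⟪WithLp.toLp 2 u - zs, metricM K τ σ (WithLp.toLp 2 u - zs)⟫ := by
  set zp : WithLp 2 (X × Y) := WithLp.toLp 2 (pdhgStep K τ σ jA jB u)
  set z : WithLp 2 (X × Y) := WithLp.toLp 2 u
  have hstep := pdhgStep_mem_kkt K hτ.ne' hσ.ne' hjA hjB u
  have hzero : (zs, (0 : WithLp 2 (X × Y))) ∈ kkt K A B := (mem_zer_iff).mp hzs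
  -- monotonicity: `0 ≤ ⟨z⁺ − z*, M(z − z⁺) − 0⟩`
  have hmono : 0 ≤ ⟪zp - zs, metricM K τ σ (z - zp) - 0⟫ := isMonotone_kkt K hA hB hzero hstep
  rw [sub_zero] at hmono
  -- `z − z* = (z⁺ − z*) + (z − z⁺)`
  have hsplit : z - zs = (zp - zs) + (z - zp) := by abel
  rw [hsplit, inner_metricM_self_add]
  linarith

variable [FiniteDimensional ℝ X] [FiniteDimensional ℝ Y]

/-- The PDHG iterates from `z₀`. [cite: ChambollePock2010, Algorithm 1] -/
noncomputable def pdhgIter (K : X →L[ℝ] Y) (τ σ : ℝ) (jA : X → X) (jB : Y → Y) (z₀ : X × Y) :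
    ℕ → X × Y
  | 0 => z₀
  | n + 1 => pdhgStep K τ σ jA jB (pdhgIter K τ σ jA jB z₀ n)

omit [FiniteDimensional ℝ X] [FiniteDimensional ℝ Y] in
/-- `pdhgStep` is continuous (resolvent maps of monotone operators are nonexpansive, `K`, `K*`
bounded). [cite: ChambollePock2010, Theorem 1 (c) (proof: passing to the limit in (7))] -/
theorem continuous_pdhgStep (K : X →L[ℝ] Y) {A : Set (X × X)} {B : Set (Y × Y)} {τ σ : ℝ}
    (hτ : 0 < τ) (hσ : 0 < σ) (hA : IsMonotone A) (hB : IsMonotone B) {jA : X → X} {jB : Y → Y}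
    (hjA : IsResolventMap τ A jA) (hjB : IsResolventMap σ B jB) :
    Continuous (pdhgStep K τ σ jA jB) := by
  have hcA : Continuous jA := hjA.continuous hA hτ
  have hcB : Continuous jB := hjB.continuous hB hσ
  have h1 : Continuous fun u : X × Y => jA (u.1 - τ • K.adjoint u.2) := by
    refine hcA.comp ?_
    exact continuous_fst.sub ((K.adjoint.continuous.comp continuous_snd).const_smul τ)
  unfold pdhgStep
  refine h1.prodMk (hcB.comp ?_)
  refine continuous_snd.add (Continuous.const_smul (K.continuous.comp ?_) σ)
  exact (h1.const_smul (2 : ℝ)).sub continuous_fst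

/-- **Chambolle–Pock, Theorem 1 (c): convergence of PDHG in finite dimension.** Let `X`, `Y` be
finite-dimensional real Hilbert spaces, `K : X → Y` linear, `A ⊂ X × X`, `B ⊂ Y × Y` monotone with
resolvent maps `jA = J_{τA}`, `jB = J_{σB}`, step sizes `τ, σ > 0` with `τσ‖K‖² < 1`, and assume a
saddle point exists (`zer F ≠ ∅`, `F = (A + K*·) × (B − K·)`). Then the iterates of `pdhgStep` converge to
a saddle point: "If the dimension of the spaces `X` and `Y` is finite, then there exists a
saddle-point `(x*, y*)` such that `x^n → x*` and `y^n → y*`." Proof as printed (p. 7: (a) ⇒ bounded ⇒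
a converging subsequence; `z^{n+1} − z^n → 0` and continuity ⇒ the cluster point is a fixed point,
i.e. a saddle point; Fejér monotonicity towards it ⇒ the whole sequence converges), run in the metric
`M_{τ,σ}` of the proximal-point interpretation. [cite: ChambollePock2010, Theorem 1 (c)]
[cite: HeYuan2012, §2 (PPA interpretation)] -/
theorem tendsto_pdhgIter (K : X →L[ℝ] Y) {A : Set (X × X)} {B : Set (Y × Y)} {τ σ : ℝ}
    (hτ : 0 < τ) (hσ : 0 < σ) (hK : τ * σ * ‖K‖ ^ 2 < 1) (hA : IsMonotone A) (hB : IsMonotone B)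
    {jA : X → X} {jB : Y → Y} (hjA : IsResolventMap τ A jA) (hjB : IsResolventMap σ B jB)
    (hsad : (zer (kkt K A B)).Nonempty) (z₀ : X × Y) :
    ∃ zs : X × Y, WithLp.toLp 2 zs ∈ zer (kkt K A B) ∧
      Filter.Tendsto (pdhgIter K τ σ jA jB z₀) Filter.atTop (nhds zs) := by
  -- notation
  set z : ℕ → X × Y := pdhgIter K τ σ jA jB z₀ with hzdef
  have hzsucc : ∀ n, z (n + 1) = pdhgStep K τ σ jA jB (z n) := fun n => rfl
  let q : X × Y → ℝ := fun d => ⟪WithLp.toLp 2 d, metricM K τ σ (WithLp.toLp 2 d)⟫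
  -- coercivity of `q`
  set c₀ : ℝ := 1 - Real.sqrt (τ * σ) * ‖K‖ with hc₀
  have hc₀pos : 0 < c₀ := by
    have h0 : 0 ≤ Real.sqrt (τ * σ) * ‖K‖ := by positivity
    have h1 : (Real.sqrt (τ * σ) * ‖K‖) ^ 2 < 1 := by
      rw [mul_pow, Real.sq_sqrt (by positivity)]; exact hK
    rw [hc₀]; nlinarith
  have hq_ge : ∀ d : X × Y, c₀ * (τ⁻¹ * ‖d.1‖ ^ 2 + σ⁻¹ * ‖d.2‖ ^ 2) ≤ q d := fun d => by
    have := inner_metricM_self_ge K hτ hσ (WithLp.toLp 2 d)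
    rw [hc₀]
    exact this
  have hq_nn : ∀ d : X × Y, 0 ≤ q d := fun d =>
    (mul_nonneg hc₀pos.le (by positivity)).trans (hq_ge d)
  have hq_fst : ∀ d : X × Y, ‖d.1‖ ^ 2 ≤ τ / c₀ * q d := fun d => by
    have h := hq_ge d
    have h2 : c₀ * (τ⁻¹ * ‖d.1‖ ^ 2) ≤ q d :=
      (mul_le_mul_of_nonneg_left (le_add_of_nonneg_right (by positivity)) hc₀pos.le).trans h
    rw [div_mul_eq_mul_div, le_div_iff₀ hc₀pos]
    have : c₀ * (τ⁻¹ * ‖d.1‖ ^ 2) * τ = ‖d.1‖ ^ 2 * c₀ := by field_simp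
    nlinarith [this]
  have hq_snd : ∀ d : X × Y, ‖d.2‖ ^ 2 ≤ σ / c₀ * q d := fun d => by
    have h := hq_ge d
    have h2 : c₀ * (σ⁻¹ * ‖d.2‖ ^ 2) ≤ q d :=
      (mul_le_mul_of_nonneg_left (le_add_of_nonneg_left (by positivity)) hc₀pos.le).trans h
    rw [div_mul_eq_mul_div, le_div_iff₀ hc₀pos]
    have : c₀ * (σ⁻¹ * ‖d.2‖ ^ 2) * σ = ‖d.2‖ ^ 2 * c₀ := by field_simp
    nlinarith [this]
  -- `q` is continuous
  have hq_cont : Continuous q := by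
    have e : q = fun d : X × Y => τ⁻¹ * ‖d.1‖ ^ 2 - 2 * ⟪K d.1, d.2⟫ + σ⁻¹ * ‖d.2‖ ^ 2 := by
      funext d
      simp only [q, inner_metricM_self, WithLp.toLp_fst, WithLp.toLp_snd]
    rw [e]
    fun_prop
  -- Fejér w.r.t. any saddle point `p`: `q(z_{n+1} − p) + q(z_n − z_{n+1}) ≤ q(z_n − p)`
  have hfejer : ∀ p : X × Y, WithLp.toLp 2 p ∈ zer (kkt K A B) →
      ∀ n, q (z (n + 1) - p) + q (z n - z (n + 1)) ≤ q (z n - p) := fun p hp n => by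
    have h := fejer_step K hτ hσ hA hB hjA hjB hp (z n)
    rw [hzsucc]
    simpa [q, WithLp.toLp_sub] using h
  -- a saddle point
  obtain ⟨ps, hps⟩ := hsad
  set p₀ : X × Y := WithLp.ofLp ps with hp₀
  have hp₀z : WithLp.toLp 2 p₀ ∈ zer (kkt K A B) := hps
  -- (a): `q(z_n − p₀)` nonincreasing, hence bounded by `q(z₀ − p₀)`
  have hmono : ∀ n, q (z (n + 1) - p₀) ≤ q (z n - p₀) := fun n => by
    linarith [hfejer p₀ hp₀z n, hq_nn (z n - z (n + 1))]
  have hbound : ∀ n, q (z n - p₀) ≤ q (z 0 - p₀) := fun n => by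
    induction n with
    | zero => exact le_rfl
    | succ n ih => exact (hmono n).trans ih
  -- the steps are square-summable in `q`, hence tend to zero
  have hsum : ∀ N, ∑ n ∈ Finset.range N, q (z n - z (n + 1)) ≤ q (z 0 - p₀) := fun N => by
    have htel : ∀ N, ∑ n ∈ Finset.range N, q (z n - z (n + 1)) ≤ q (z 0 - p₀) - q (z N - p₀) := by
      intro N
      induction N with
      | zero => simp
      | succ N ih =>
          rw [Finset.sum_range_succ]
          linarith [hfejer p₀ hp₀z N]
    linarith [htel N, hq_nn (z N - p₀)]
  have hstep0 : Filter.Tendsto (fun n => q (z n - z (n + 1))) Filter.atTop (nhds 0) := by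
    have hs : Summable fun n => q (z n - z (n + 1)) :=
      summable_of_sum_range_le (fun n => hq_nn _) hsum
    exact hs.tendsto_atTop_zero
  -- boundedness of the iterates
  set Rx : ℝ := Real.sqrt (τ / c₀ * q (z 0 - p₀)) with hRx
  set Ry : ℝ := Real.sqrt (σ / c₀ * q (z 0 - p₀)) with hRy
  have hmem : ∀ n, z n ∈ Metric.closedBall p₀ (Rx + Ry) := fun n => by
    rw [Metric.mem_closedBall, dist_eq_norm]
    have h1 : ‖(z n - p₀).1‖ ≤ Rx := by
      rw [hRx]
      refine Real.le_sqrt_of_sq_le ?_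
      exact (hq_fst _).trans (mul_le_mul_of_nonneg_left (hbound n) (by positivity))
    have h2 : ‖(z n - p₀).2‖ ≤ Ry := by
      rw [hRy]
      refine Real.le_sqrt_of_sq_le ?_
      exact (hq_snd _).trans (mul_le_mul_of_nonneg_left (hbound n) (by positivity))
    calc ‖z n - p₀‖ = max ‖(z n - p₀).1‖ ‖(z n - p₀).2‖ := rfl
      _ ≤ Rx + Ry := max_le (h1.trans (le_add_of_nonneg_right (Real.sqrt_nonneg _)))
          (h2.trans (le_add_of_nonneg_left (Real.sqrt_nonneg _)))
  -- a converging subsequence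
  obtain ⟨zbar, -, φ, hφ, hlim⟩ :=
    tendsto_subseq_of_bounded (Metric.isBounded_closedBall) hmem
  -- the cluster point is a fixed point of the (continuous) step
  have hcont := continuous_pdhgStep K hτ hσ hA hB hjA hjB
  have hnext : Filter.Tendsto (fun k => z (φ k + 1)) Filter.atTop (nhds (pdhgStep K τ σ jA jB zbar)) := by
    have := (hcont.tendsto zbar).comp hlim
    simpa [Function.comp_def, hzsucc] using this
  -- but also `z(φ k + 1) → zbar` since the steps tend to zero
  have hdiff : Filter.Tendsto (fun k => z (φ k) - z (φ k + 1)) Filter.atTop (nhds 0) := by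
    have hq0 : Filter.Tendsto (fun k => q (z (φ k) - z (φ k + 1))) Filter.atTop (nhds 0) :=
      hstep0.comp hφ.tendsto_atTop
    rw [tendsto_iff_norm_sub_tendsto_zero]
    simp only [sub_zero]
    have h1 : Filter.Tendsto (fun k => ‖(z (φ k) - z (φ k + 1)).1‖) Filter.atTop (nhds 0) := by
      have hsq : Filter.Tendsto (fun k => ‖(z (φ k) - z (φ k + 1)).1‖ ^ 2) Filter.atTop (nhds 0) := by
        refine squeeze_zero (fun k => by positivity) (fun k => hq_fst _) ?_
        simpa using hq0.const_mul (τ / c₀)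
      have := hsq.sqrt
      simpa [Real.sqrt_sq (norm_nonneg _)] using this
    have h2 : Filter.Tendsto (fun k => ‖(z (φ k) - z (φ k + 1)).2‖) Filter.atTop (nhds 0) := by
      have hsq : Filter.Tendsto (fun k => ‖(z (φ k) - z (φ k + 1)).2‖ ^ 2) Filter.atTop (nhds 0) := by
        refine squeeze_zero (fun k => by positivity) (fun k => hq_snd _) ?_
        simpa using hq0.const_mul (σ / c₀)
      have := hsq.sqrt
      simpa [Real.sqrt_sq (norm_nonneg _)] using this
    have hmax := h1.max h2
    simpa [Prod.norm_def] using hmax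
  have hnext' : Filter.Tendsto (fun k => z (φ k + 1)) Filter.atTop (nhds zbar) := by
    have := hlim.sub hdiff
    simpa [Function.comp_def] using this
  have hfix : pdhgStep K τ σ jA jB zbar = zbar := tendsto_nhds_unique hnext hnext'
  have hzbar : WithLp.toLp 2 zbar ∈ zer (kkt K A B) :=
    (pdhgStep_eq_self_iff K hτ hσ hA hB hjA hjB zbar).mp hfix
  -- Fejér towards `zbar`: `b_n = q(z_n − zbar)` is nonincreasing and `b_{φ k} → 0`
  have hbmono : ∀ n, q (z (n + 1) - zbar) ≤ q (z n - zbar) := fun n => by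
    linarith [hfejer zbar hzbar n, hq_nn (z n - z (n + 1))]
  have hbanti : Antitone fun n => q (z n - zbar) := antitone_nat_of_succ_le hbmono
  have hbsub : Filter.Tendsto (fun k => q (z (φ k) - zbar)) Filter.atTop (nhds 0) := by
    have h1 : Filter.Tendsto (fun k => z (φ k) - zbar) Filter.atTop (nhds (zbar - zbar)) :=
      hlim.sub tendsto_const_nhds
    rw [sub_self] at h1
    have h2 := (hq_cont.tendsto 0).comp h1
    have hq00 : q 0 = 0 := by simp [q]
    simpa [Function.comp_def, hq00] using h2
  have hb0 : Filter.Tendsto (fun n => q (z n - zbar)) Filter.atTop (nhds 0) := by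
    rw [Metric.tendsto_atTop]
    intro ε hε
    obtain ⟨k, hk⟩ := (Metric.tendsto_atTop.mp hbsub) ε hε
    refine ⟨φ k, fun n hn => ?_⟩
    have h1 := hk k le_rfl
    rw [Real.dist_eq, sub_zero, abs_of_nonneg (hq_nn _)] at h1 ⊢
    exact lt_of_le_of_lt (hbanti hn) h1
  -- conclude: both components converge
  refine ⟨zbar, hzbar, ?_⟩
  rw [tendsto_iff_norm_sub_tendsto_zero]
  have h1 : Filter.Tendsto (fun n => ‖(z n - zbar).1‖) Filter.atTop (nhds 0) := by
    have hsq : Filter.Tendsto (fun n => ‖(z n - zbar).1‖ ^ 2) Filter.atTop (nhds 0) := by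
      refine squeeze_zero (fun n => by positivity) (fun n => hq_fst _) ?_
      simpa using hb0.const_mul (τ / c₀)
    have := hsq.sqrt
    simpa [Real.sqrt_sq (norm_nonneg _)] using this
  have h2 : Filter.Tendsto (fun n => ‖(z n - zbar).2‖) Filter.atTop (nhds 0) := by
    have hsq : Filter.Tendsto (fun n => ‖(z n - zbar).2‖ ^ 2) Filter.atTop (nhds 0) := by
      refine squeeze_zero (fun n => by positivity) (fun n => hq_snd _) ?_
      simpa using hb0.const_mul (σ / c₀)
    have := hsq.sqrt
    simpa [Real.sqrt_sq (norm_nonneg _)] using this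
  have hmax := h1.max h2
  simpa [Prod.norm_def] using hmax

end Convergence

/-! ### The conic / constrained bilinear saddle: resolvents are projections (the PDLP-type kernel) -/

section Conic

open Literature.Analysis.Convex.DouglasRachford (normalCone mem_normalCone_iff isMonotone_normalCone
  isResolventMap_proj)
open Literature.Analysis.Convex.ConvexMetricProjection (proj proj_mem)

variable {H : Type*} [NormedAddCommGroup H] [InnerProductSpace ℝ H]

/-- The operator translated by a constant vector, `(c + T)(x) = c + T(x)` — the subdifferential of
`x ↦ ⟨c, x⟩ + g(x)` when `T = ∂g`. [cite: ChambollePock2010, §2 (2) (the linear terms of the saddle function)] -/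
def shiftOp (c : H) (T : Set (H × H)) : Set (H × H) := {p | (p.1, p.2 - c) ∈ T}

omit [InnerProductSpace ℝ H] in
/-- Membership in the translated operator. [cite: ChambollePock2010, §2 (2)] -/
theorem mem_shiftOp_iff [InnerProductSpace ℝ H] {c : H} {T : Set (H × H)} {x y : H} :
    (x, y) ∈ shiftOp c T ↔ (x, y - c) ∈ T := Iff.rfl

/-- Translation preserves monotonicity. [cite: ChambollePock2010, §2 (2)] -/
theorem isMonotone_shiftOp (c : H) {T : Set (H × H)} (hT : IsMonotone T) :
    IsMonotone (shiftOp c T) := by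
  intro x y hxy x' y' hxy'
  have h := hT (mem_shiftOp_iff.mp hxy) (mem_shiftOp_iff.mp hxy')
  simpa using h

/-- The resolvent map of the translated operator: `J_{γ(c + T)}(z) = J_{γT}(z − γc)`
(the proximal map of `⟨c, ·⟩ + g` is `prox_g(· − γc)`). [cite: ChambollePock2010, §2 (resolvent/proximity operators)] -/
theorem isResolventMap_shiftOp {c : H} {T : Set (H × H)} {γ : ℝ} {j : H → H}
    (hj : IsResolventMap γ T j) : IsResolventMap γ (shiftOp c T) fun z => j (z - γ • c) := by
  intro z
  obtain ⟨y, hy, hz⟩ := (mem_resolvent_iff).mp (hj (z - γ • c))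
  refine (mem_resolvent_iff).mpr ⟨y + c, ?_, ?_⟩
  · exact mem_shiftOp_iff.mpr (by simpa using hy)
  · rw [smul_add]
    calc j (z - γ • c) + (γ • y + γ • c) = (j (z - γ • c) + γ • y) + γ • c := by abel
      _ = z := by rw [hz]; abel

/-- **The constrained bilinear (conic) saddle-point problem**
`min_{x ∈ C} max_{y ∈ D} ⟨c, x⟩ + ⟨Kx, y⟩ − ⟨b, y⟩` — the Lagrangian of the conic program
`min ⟨c, x⟩ s.t. Kx − b ∈ D°-constraints, x ∈ C` (for `C`, `D` closed convex cones this is the standard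
conic LP/SDP saddle used by PDLP-type solvers): its KKT operator is `kkt K (c + N_C) (b + N_D)`, and a
zero `(x̄, ȳ)` is exactly a saddle point: `x̄ ∈ C`, `ȳ ∈ D`,
`⟨c + K* ȳ, x − x̄⟩ ≥ 0 ∀ x ∈ C` and `⟨K x̄ − b, y − ȳ⟩ ≤ 0 ∀ y ∈ D`.
[cite: ChambollePock2010, §2 (2) and §3.1 (saddle point / partial primal-dual gap)] -/
theorem mem_zer_kkt_conic_iff (K : X →L[ℝ] Y) (C : Set X) (D : Set Y) (c : X) (b : Y)
    (z : WithLp 2 (X × Y)) :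
    z ∈ zer (kkt K (shiftOp c (normalCone C)) (shiftOp b (normalCone D))) ↔
      (z.fst ∈ C ∧ ∀ x ∈ C, 0 ≤ ⟪c + K.adjoint z.snd, x - z.fst⟫) ∧
      (z.snd ∈ D ∧ ∀ y ∈ D, ⟪K z.fst - b, y - z.snd⟫ ≤ 0) := by
  rw [mem_zer_kkt_iff, mem_shiftOp_iff, mem_shiftOp_iff, mem_normalCone_iff, mem_normalCone_iff]
  constructor
  · rintro ⟨⟨hxC, hx⟩, ⟨hyD, hy⟩⟩
    refine ⟨⟨hxC, fun x hx' => ?_⟩, ⟨hyD, fun y hy' => ?_⟩⟩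
    · have h := hx x hx'
      have e : -K.adjoint z.snd - c = -(c + K.adjoint z.snd) := by abel
      rw [e, inner_neg_left] at h
      linarith
    · exact hy y hy'
  · rintro ⟨⟨hxC, hx⟩, ⟨hyD, hy⟩⟩
    refine ⟨⟨hxC, fun x hx' => ?_⟩, ⟨hyD, fun y hy' => hy y hy'⟩⟩
    have e : -K.adjoint z.snd - c = -(c + K.adjoint z.snd) := by abel
    rw [e, inner_neg_left]
    linarith [hx x hx']

/-- **PDHG for the conic saddle converges (Chambolle–Pock Thm 1 (c), projection form).** For
finite-dimensional `X`, `Y`, nonempty closed convex `C ⊂ X`, `D ⊂ Y`, `τ, σ > 0` with `τσ‖K‖² < 1`,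
the iteration `x⁺ = P_C(x − τ(K* y + c))`, `y⁺ = P_D(y + σ(K(2x⁺ − x) − b))` — `pdhgStep` with the
resolvent maps `z ↦ P_C(z − τc)`, `z ↦ P_D(z − σb)` of `c + N_C`, `b + N_D` — converges to a saddle point
of `⟨c, x⟩ + ⟨Kx, y⟩ − ⟨b, y⟩` on `C × D` whenever one exists. (The kernel of PDLP-type conic solvers,
without restarts / adaptive steps.) [cite: ChambollePock2010, Theorem 1 (c)] [cite: ChambollePock2015, §3 (11)–(12)] -/
theorem tendsto_pdhgIter_conic [FiniteDimensional ℝ X] [FiniteDimensional ℝ Y] (K : X →L[ℝ] Y)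
    {C : Set X} {D : Set Y} (hCne : C.Nonempty) (hCcl : IsClosed C) (hCc : Convex ℝ C)
    (hDne : D.Nonempty) (hDcl : IsClosed D) (hDc : Convex ℝ D) (c : X) (b : Y) {τ σ : ℝ}
    (hτ : 0 < τ) (hσ : 0 < σ) (hK : τ * σ * ‖K‖ ^ 2 < 1)
    (hsad : (zer (kkt K (shiftOp c (normalCone C)) (shiftOp b (normalCone D)))).Nonempty)
    (z₀ : X × Y) :
    ∃ zs : X × Y, WithLp.toLp 2 zs ∈ zer (kkt K (shiftOp c (normalCone C)) (shiftOp b (normalCone D))) ∧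
      Filter.Tendsto
        (pdhgIter K τ σ (fun z => proj C (z - τ • c)) (fun z => proj D (z - σ • b)) z₀)
        Filter.atTop (nhds zs) :=
  tendsto_pdhgIter K hτ hσ hK (isMonotone_shiftOp c (isMonotone_normalCone C))
    (isMonotone_shiftOp b (isMonotone_normalCone D))
    (isResolventMap_shiftOp (isResolventMap_proj hCne hCcl.isComplete hCc hτ))
    (isResolventMap_shiftOp (isResolventMap_proj hDne hDcl.isComplete hDc hσ)) hsad z₀

/-! #### The ergodic `O(1/N)` rate of the primal–dual gap (Chambolle–Pock 2016, Theorem 1, the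
bilinear-conic case `f = 0`, Euclidean `D_x`, `D_y`) -/

/-- The Lagrangian of the constrained bilinear saddle-point problem,
`L(x, y) = ⟨c, x⟩ + ⟨Kx, y⟩ − ⟨b, y⟩` (on `C × D`). [cite: ChambollePock2015, §1 (1) with f = 0, g = ⟨c,·⟩ + ι_C, h* = ⟨b,·⟩ + ι_D] -/
noncomputable def conicL (K : X →L[ℝ] Y) (c : X) (b : Y) (x : X) (y : Y) : ℝ :=
  ⟪c, x⟫ + ⟪K x, y⟫ - ⟪b, y⟫

/-- Three-point identity of the metric: `2⟨u, M v⟩ = q(u + v) − q(u) − q(v)` with `q(d) = ⟨d, M d⟩`.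
[cite: ChambollePock2015, §3 (12)] -/
theorem two_mul_inner_metricM (K : X →L[ℝ] Y) (τ σ : ℝ) (u v : WithLp 2 (X × Y)) :
    2 * ⟪u, metricM K τ σ v⟫ =
      ⟪u + v, metricM K τ σ (u + v)⟫ - ⟪u, metricM K τ σ u⟫ - ⟪v, metricM K τ σ v⟫ := by
  rw [inner_metricM_self_add]; ring

/-- **The one-step gap inequality** (the inequality summed in the proof of [ChambollePock2015, Thm 1],
conic case): for `z⁺ = pdhgStep z` with the resolvent maps of `c + N_C`, `b + N_D`, and any
`(ξ, η) ∈ C × D`,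
`L(x⁺, η) − L(ξ, y⁺) ≤ ½ (‖z − ζ‖²_M − ‖z⁺ − ζ‖²_M − ‖z − z⁺‖²_M)`, `ζ = (ξ, η)`.
Mechanism: the normal-cone inequalities at `x⁺`, `y⁺` turn the linear terms into `⟨M(z − z⁺), z⁺ − ζ⟩`
(identity (12)), the bilinear terms cancel, and the three-point identity of `M` finishes.
[cite: ChambollePock2015, Theorem 1 (proof, f = 0)] -/
theorem conicL_step_le (K : X →L[ℝ] Y) {C : Set X} {D : Set Y} (c : X) (b : Y) {τ σ : ℝ}
    (hτ : 0 < τ) (hσ : 0 < σ) {jA : X → X} {jB : Y → Y}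
    (hjA : IsResolventMap τ (shiftOp c (normalCone C)) jA)
    (hjB : IsResolventMap σ (shiftOp b (normalCone D)) jB) (u : X × Y) {ξ : X} (hξ : ξ ∈ C)
    {η : Y} (hη : η ∈ D) :
    conicL K c b (pdhgStep K τ σ jA jB u).1 η - conicL K c b ξ (pdhgStep K τ σ jA jB u).2 ≤
      2⁻¹ * (⟪WithLp.toLp 2 u - WithLp.toLp 2 (ξ, η),
              metricM K τ σ (WithLp.toLp 2 u - WithLp.toLp 2 (ξ, η))⟫ -
            ⟪WithLp.toLp 2 (pdhgStep K τ σ jA jB u) - WithLp.toLp 2 (ξ, η),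
              metricM K τ σ (WithLp.toLp 2 (pdhgStep K τ σ jA jB u) - WithLp.toLp 2 (ξ, η))⟫ -
            ⟪WithLp.toLp 2 u - WithLp.toLp 2 (pdhgStep K τ σ jA jB u),
              metricM K τ σ (WithLp.toLp 2 u - WithLp.toLp 2 (pdhgStep K τ σ jA jB u))⟫) := by
  set zp : WithLp 2 (X × Y) := WithLp.toLp 2 (pdhgStep K τ σ jA jB u) with hzp
  set z : WithLp 2 (X × Y) := WithLp.toLp 2 u with hz
  set ζ : WithLp 2 (X × Y) := WithLp.toLp 2 (ξ, η) with hζ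
  set xp := (pdhgStep K τ σ jA jB u).1 with hxp
  set yp := (pdhgStep K τ σ jA jB u).2 with hyp
  have hzpf : zp.fst = xp := rfl
  have hzps : zp.snd = yp := rfl
  -- identity (12) for this step
  obtain ⟨a, b', ha, hb, h1, h2⟩ := (mem_kkt_iff).mp (pdhgStep_mem_kkt K hτ.ne' hσ.ne' hjA hjB u)
  rw [hzpf] at ha h2
  rw [hzps] at hb h1
  -- the normal-cone inequalities
  obtain ⟨-, hNa⟩ := mem_normalCone_iff.mp (mem_shiftOp_iff.mp ha)
  obtain ⟨-, hNb⟩ := mem_normalCone_iff.mp (mem_shiftOp_iff.mp hb)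
  have hA' : ⟪c, xp - ξ⟫ ≤ ⟪a, xp - ξ⟫ := by
    have h := hNa ξ hξ
    rw [inner_sub_left] at h
    have e1 : ⟪c, xp - ξ⟫ = -⟪c, ξ - xp⟫ := by rw [← inner_neg_right, neg_sub]
    have e2 : ⟪a, xp - ξ⟫ = -⟪a, ξ - xp⟫ := by rw [← inner_neg_right, neg_sub]
    linarith
  have hB' : ⟪b, yp - η⟫ ≤ ⟪b', yp - η⟫ := by
    have h := hNb η hη
    rw [inner_sub_left] at h
    have e1 : ⟪b, yp - η⟫ = -⟪b, η - yp⟫ := by rw [← inner_neg_right, neg_sub]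
    have e2 : ⟪b', yp - η⟫ = -⟪b', η - yp⟫ := by rw [← inner_neg_right, neg_sub]
    linarith
  -- the gap in terms of `a`, `b'`
  have hgap : conicL K c b xp η - conicL K c b ξ yp =
      ⟪c, xp - ξ⟫ + ⟪b, yp - η⟫ + ⟪K xp, η⟫ - ⟪K ξ, yp⟫ := by
    simp only [conicL, inner_sub_right]; ring
  -- `⟨M(z − z⁺), z⁺ − ζ⟩` expanded
  have hM : ⟪z - zp, metricM K τ σ (zp - ζ)⟫ =
      ⟪a, xp - ξ⟫ + ⟪b', yp - η⟫ + ⟪K xp, η⟫ - ⟪K ξ, yp⟫ := by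
    rw [inner_metricM_comm, WithLp.prod_inner_apply]
    simp only [WithLp.ofLp_fst, WithLp.ofLp_snd, WithLp.sub_fst, WithLp.sub_snd]
    rw [h1, h2]
    have eζf : ζ.fst = ξ := rfl
    have eζs : ζ.snd = η := rfl
    rw [hzpf, hzps, eζf, eζs]
    simp only [inner_add_left, inner_sub_left, inner_sub_right,
      ContinuousLinearMap.adjoint_inner_left]
    rw [real_inner_comm (K xp) yp, real_inner_comm (K ξ) yp]
    ring
  have hthree := two_mul_inner_metricM K τ σ (z - zp) (zp - ζ)
  have hsum : z - zp + (zp - ζ) = z - ζ := by abel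
  rw [hsum] at hthree
  rw [hgap]
  linarith

/-- The ergodic (averaged) primal iterate `X_N = N⁻¹ Σ_{n=1}^{N} x^n`. [cite: ChambollePock2015, Theorem 1 (X^N, Y^N)] -/
noncomputable def xAvg (z : ℕ → X × Y) (N : ℕ) : X :=
  (N : ℝ)⁻¹ • ∑ n ∈ Finset.range N, (z (n + 1)).1

/-- The ergodic (averaged) dual iterate `Y_N = N⁻¹ Σ_{n=1}^{N} y^n`. [cite: ChambollePock2015, Theorem 1 (X^N, Y^N)] -/
noncomputable def yAvg (z : ℕ → X × Y) (N : ℕ) : Y :=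
  (N : ℝ)⁻¹ • ∑ n ∈ Finset.range N, (z (n + 1)).2

omit [CompleteSpace X] [CompleteSpace Y] in
/-- `L(·, η)` is affine: its value at the average is the average of its values. [cite: ChambollePock2015, Theorem 1 (proof, convexity step)] -/
theorem conicL_xAvg (K : X →L[ℝ] Y) (c : X) (b : Y)
    (z : ℕ → X × Y) {N : ℕ} (hN : N ≠ 0) (η : Y) :
    conicL K c b (xAvg z N) η = (N : ℝ)⁻¹ * ∑ n ∈ Finset.range N, conicL K c b (z (n + 1)).1 η := by
  have hN' : (N : ℝ) ≠ 0 := Nat.cast_ne_zero.mpr hN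
  simp only [conicL, xAvg, inner_smul_right, map_smul, map_sum, inner_smul_left, sum_inner,
    inner_sum, conj_trivial, Finset.sum_add_distrib, Finset.sum_sub_distrib, Finset.sum_const,
    Finset.card_range, nsmul_eq_mul]
  field_simp

omit [CompleteSpace X] [CompleteSpace Y] in
/-- `L(ξ, ·)` is affine: its value at the average is the average of its values. [cite: ChambollePock2015, Theorem 1 (proof, concavity step)] -/
theorem conicL_yAvg (K : X →L[ℝ] Y) (c : X) (b : Y)
    (z : ℕ → X × Y) {N : ℕ} (hN : N ≠ 0) (ξ : X) :
    conicL K c b ξ (yAvg z N) = (N : ℝ)⁻¹ * ∑ n ∈ Finset.range N, conicL K c b ξ (z (n + 1)).2 := by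
  have hN' : (N : ℝ) ≠ 0 := Nat.cast_ne_zero.mpr hN
  simp only [conicL, yAvg, inner_smul_right, inner_sum, Finset.sum_add_distrib,
    Finset.sum_sub_distrib, Finset.sum_const, Finset.card_range, nsmul_eq_mul]
  field_simp

/-- **Chambolle–Pock 2016, Theorem 1 (ergodic `O(1/N)` rate), constrained bilinear case.** For the
PDHG iterates `z^n = (x^n, y^n)` of the conic saddle (resolvent maps of `c + N_C`, `b + N_D`, e.g. the
projections `P_C(· − τc)`, `P_D(· − σb)`), step sizes `τ, σ > 0` with `τσ‖K‖² ≤ 1` (the printed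
condition (13) with `L_f = 0`), and every `(x, y) ∈ C × D` and `N ≥ 1`:
`L(X_N, y) − L(x, Y_N) ≤ (1/N) · (‖x − x⁰‖²/(2τ) + ‖y − y⁰‖²/(2σ) − ⟨K(x − x⁰), y − y⁰⟩)`,
where `X_N = N⁻¹ Σ_{n=1}^N x^n`, `Y_N = N⁻¹ Σ_{n=1}^N y^n` — the right-hand side is `‖z⁰ − (x,y)‖²_M / (2N)`.
(Sum the one-step inequalities, drop the nonpositive terms, divide by `N`, and use affinity of `L` in
each argument.) [cite: ChambollePock2015, Theorem 1 ((13)–(14), f = 0, Euclidean D_x, D_y)] -/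
theorem conicL_gap_ergodic_le (K : X →L[ℝ] Y) {C : Set X} {D : Set Y} (c : X) (b : Y)
    {τ σ : ℝ} (hτ : 0 < τ) (hσ : 0 < σ) (hK : τ * σ * ‖K‖ ^ 2 ≤ 1) {jA : X → X} {jB : Y → Y}
    (hjA : IsResolventMap τ (shiftOp c (normalCone C)) jA)
    (hjB : IsResolventMap σ (shiftOp b (normalCone D)) jB) (z₀ : X × Y) {ξ : X} (hξ : ξ ∈ C)
    {η : Y} (hη : η ∈ D) {N : ℕ} (hN : N ≠ 0) :
    conicL K c b (xAvg (pdhgIter K τ σ jA jB z₀) N) η -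
        conicL K c b ξ (yAvg (pdhgIter K τ σ jA jB z₀) N) ≤
      (N : ℝ)⁻¹ * (2⁻¹ * ⟪WithLp.toLp 2 z₀ - WithLp.toLp 2 (ξ, η),
        metricM K τ σ (WithLp.toLp 2 z₀ - WithLp.toLp 2 (ξ, η))⟫) := by
  set z : ℕ → X × Y := pdhgIter K τ σ jA jB z₀ with hzdef
  have hzsucc : ∀ n, z (n + 1) = pdhgStep K τ σ jA jB (z n) := fun n => rfl
  let q : X × Y → ℝ := fun d => ⟪WithLp.toLp 2 d, metricM K τ σ (WithLp.toLp 2 d)⟫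
  -- `q ≥ 0` under `τσ‖K‖² ≤ 1`
  have hq_nn : ∀ d : X × Y, 0 ≤ q d := fun d => by
    have h := inner_metricM_self_ge K hτ hσ (WithLp.toLp 2 d)
    have hcoef : 0 ≤ 1 - Real.sqrt (τ * σ) * ‖K‖ := by
      have h0 : 0 ≤ Real.sqrt (τ * σ) * ‖K‖ := by positivity
      have h1 : (Real.sqrt (τ * σ) * ‖K‖) ^ 2 ≤ 1 := by
        rw [mul_pow, Real.sq_sqrt (by positivity)]; exact hK
      nlinarith
    exact (mul_nonneg hcoef (by positivity)).trans h
  -- one-step inequalities, in terms of `q`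
  have hstep : ∀ n, conicL K c b (z (n + 1)).1 η - conicL K c b ξ (z (n + 1)).2 ≤
      2⁻¹ * (q (z n - (ξ, η)) - q (z (n + 1) - (ξ, η)) - q (z n - z (n + 1))) := fun n => by
    have h := conicL_step_le K c b hτ hσ hjA hjB (z n) hξ hη
    rw [hzsucc]
    simpa [q, WithLp.toLp_sub] using h
  -- telescope
  have htel : ∀ N, ∑ n ∈ Finset.range N,
      (conicL K c b (z (n + 1)).1 η - conicL K c b ξ (z (n + 1)).2) ≤
      2⁻¹ * (q (z 0 - (ξ, η)) - q (z N - (ξ, η))) := by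
    intro N
    induction N with
    | zero => simp
    | succ N ih =>
        rw [Finset.sum_range_succ]
        have h := hstep N
        have hnn := hq_nn (z N - z (N + 1))
        linarith
  have hsumle : ∑ n ∈ Finset.range N,
      (conicL K c b (z (n + 1)).1 η - conicL K c b ξ (z (n + 1)).2) ≤ 2⁻¹ * q (z 0 - (ξ, η)) := by
    have h := htel N
    have hnn := hq_nn (z N - (ξ, η))
    linarith
  -- average
  have hN' : (0 : ℝ) < N := Nat.cast_pos.mpr (Nat.pos_of_ne_zero hN)
  rw [conicL_xAvg K c b z hN η, conicL_yAvg K c b z hN ξ, ← mul_sub, ← Finset.sum_sub_distrib]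
  have hz0 : z 0 = z₀ := rfl
  have hq0 : q (z 0 - (ξ, η)) = ⟪WithLp.toLp 2 z₀ - WithLp.toLp 2 (ξ, η),
      metricM K τ σ (WithLp.toLp 2 z₀ - WithLp.toLp 2 (ξ, η))⟫ := by
    simp only [q, hz0, WithLp.toLp_sub]
  rw [← hq0]
  exact mul_le_mul_of_nonneg_left hsumle (inv_nonneg.mpr hN'.le)

/-! #### Saddle points of the conic Lagrangian: the KKT zeros in saddle form, existence on compact
sets (von Neumann's theorem, from the tree's Ky Fan file), the gap sandwich at a saddle point, and the
iteration without an existence hypothesis -/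

/-- The zeros of the conic KKT operator are exactly the saddle points of `L` on `C × D`:
`x̄ ∈ C`, `ȳ ∈ D` and `L(x̄, y) ≤ L(x̄, ȳ) ≤ L(x, ȳ)` for all `x ∈ C`, `y ∈ D` (both partial maps are
affine, so the variational inequalities of `mem_zer_kkt_conic_iff` are the saddle inequalities).
[cite: ChambollePock2010, §2 (2) (saddle-point problem and its optimality system)] -/
theorem mem_zer_kkt_conic_iff_saddle (K : X →L[ℝ] Y) (C : Set X) (D : Set Y) (c : X) (b : Y)
    (x' : X) (y' : Y) :
    WithLp.toLp 2 (x', y') ∈ zer (kkt K (shiftOp c (normalCone C)) (shiftOp b (normalCone D))) ↔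
      x' ∈ C ∧ y' ∈ D ∧ (∀ x ∈ C, conicL K c b x' y' ≤ conicL K c b x y') ∧
        ∀ y ∈ D, conicL K c b x' y ≤ conicL K c b x' y' := by
  rw [mem_zer_kkt_conic_iff]
  simp only [WithLp.toLp_fst, WithLp.toLp_snd]
  have ex : ∀ x, conicL K c b x y' - conicL K c b x' y' = ⟪c + K.adjoint y', x - x'⟫ := fun x => by
    simp only [conicL, inner_add_left, inner_sub_right, ContinuousLinearMap.adjoint_inner_left]
    rw [real_inner_comm (K x) y', real_inner_comm (K x') y']
    ring
  have ey : ∀ y, conicL K c b x' y - conicL K c b x' y' = ⟪K x' - b, y - y'⟫ := fun y => by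
    simp only [conicL, inner_sub_left, inner_sub_right]
    ring
  constructor
  · rintro ⟨⟨hxC, hx⟩, ⟨hyD, hy⟩⟩
    refine ⟨hxC, hyD, fun x hxC' => ?_, fun y hyD' => ?_⟩
    · have h := hx x hxC'
      rw [← ex] at h
      linarith
    · have h := hy y hyD'
      rw [← ey] at h
      linarith
  · rintro ⟨hxC, hyD, hx, hy⟩
    refine ⟨⟨hxC, fun x hxC' => ?_⟩, ⟨hyD, fun y hyD' => ?_⟩⟩
    · rw [← ex]
      linarith [hx x hxC']
    · rw [← ey]
      linarith [hy y hyD']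

omit [CompleteSpace X] [CompleteSpace Y] in
/-- `L(·, y)` is affine, hence convex, on any convex set. [cite: ChambollePock2010, §2 (the saddle function is convex–concave)] -/
theorem convexOn_conicL (K : X →L[ℝ] Y) (c : X) (b : Y) {C : Set X} (hC : Convex ℝ C) (y : Y) :
    ConvexOn ℝ C (fun x => conicL K c b x y) := by
  refine ⟨hC, fun x _ x₂ _ a a₂ _ _ hab => ?_⟩
  have heq : conicL K c b (a • x + a₂ • x₂) y = a * conicL K c b x y + a₂ * conicL K c b x₂ y := by
    simp only [conicL, inner_add_right, inner_smul_right, map_add, map_smul, inner_add_left,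
      inner_smul_left, conj_trivial]
    linear_combination ⟪b, y⟫ * hab
  simp only [smul_eq_mul]
  exact heq.le

omit [CompleteSpace X] [CompleteSpace Y] in
/-- `L(x, ·)` is affine, hence concave, on any convex set. [cite: ChambollePock2010, §2 (the saddle function is convex–concave)] -/
theorem concaveOn_conicL (K : X →L[ℝ] Y) (c : X) (b : Y) (x : X) {D : Set Y} (hD : Convex ℝ D) :
    ConcaveOn ℝ D (fun y => conicL K c b x y) := by
  refine ⟨hD, fun y _ y₂ _ a a₂ _ _ hab => ?_⟩
  have heq : a * conicL K c b x y + a₂ * conicL K c b x y₂ = conicL K c b x (a • y + a₂ • y₂) := by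
    simp only [conicL, inner_add_right, inner_smul_right]
    linear_combination ⟪c, x⟫ * hab
  simp only [smul_eq_mul]
  exact heq.le

omit [CompleteSpace X] [CompleteSpace Y] in
/-- `L` is continuous in `x`. [folklore: continuity of inner products] -/
private theorem continuous_conicL_left (K : X →L[ℝ] Y) (c : X) (b : Y) (y : Y) :
    Continuous fun x => conicL K c b x y :=
  ((continuous_const.inner continuous_id).add (K.continuous.inner continuous_const)).sub
    continuous_const

omit [CompleteSpace X] [CompleteSpace Y] in
/-- `L` is continuous in `y`. [folklore: continuity of inner products] -/
private theorem continuous_conicL_right (K : X →L[ℝ] Y) (c : X) (b : Y) (x : X) :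
    Continuous fun y => conicL K c b x y :=
  (continuous_const.add (continuous_const.inner continuous_id)).sub
    (continuous_const.inner continuous_id)

/-- **A saddle point exists on compact sets (von Neumann's minimax theorem, bilinear case).** For
nonempty compact convex `C ⊆ X`, `D ⊆ Y` the conic Lagrangian `L(x, y) = ⟨c, x⟩ + ⟨Kx, y⟩ − ⟨b, y⟩`
has a saddle point on `C × D`; equivalently the conic KKT operator has a zero. Obtained from the
tree's `KyFanInequality.exists_isSaddlePoint` (Aubin, Thm 8.2): `L` is affine and continuous in each
variable. [cite: Aubin1993, Thm 8.2 (von Neumann)] -/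
theorem zer_kkt_conic_nonempty_of_isCompact (K : X →L[ℝ] Y) {C : Set X} {D : Set Y}
    (hCne : C.Nonempty) (hCc : IsCompact C) (hCconv : Convex ℝ C) (hDne : D.Nonempty)
    (hDc : IsCompact D) (hDconv : Convex ℝ D) (c : X) (b : Y) :
    (zer (kkt K (shiftOp c (normalCone C)) (shiftOp b (normalCone D)))).Nonempty := by
  obtain ⟨x', hx', y', hy', hmin, hmax⟩ :=
    Literature.Analysis.Convex.KyFanInequality.exists_isSaddlePoint hCc hCconv hCne hDc hDconv hDne
      (f := conicL K c b)
      (fun y _ => (continuous_conicL_left K c b y).continuousOn.lowerSemicontinuousOn)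
      (fun y _ => convexOn_conicL K c b hCconv y)
      (fun x _ => (continuous_conicL_right K c b x).continuousOn.upperSemicontinuousOn)
      (fun x _ => concaveOn_conicL K c b x hDconv)
  exact ⟨WithLp.toLp 2 (x', y'),
    (mem_zer_kkt_conic_iff_saddle K C D c b x' y').mpr ⟨hx', hy', hmin, hmax⟩⟩

omit [CompleteSpace X] [NormedAddCommGroup Y] [InnerProductSpace ℝ Y] [CompleteSpace Y] in
/-- Averages of points of a convex set lie in the set. [folklore: convex combinations] -/
private theorem xAvg_mem {C : Set X} (hC : Convex ℝ C) {z : ℕ → X × Y}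
    (hz : ∀ n, (z (n + 1)).1 ∈ C) {N : ℕ} (hN : N ≠ 0) : xAvg z N ∈ C := by
  unfold xAvg
  rw [Finset.smul_sum]
  refine hC.sum_mem (fun _ _ => by positivity) ?_ (fun n _ => hz n)
  rw [Finset.sum_const, Finset.card_range, nsmul_eq_mul,
    mul_inv_cancel₀ (Nat.cast_ne_zero.mpr hN)]

omit [NormedAddCommGroup X] [InnerProductSpace ℝ X] [CompleteSpace X] [CompleteSpace Y] in
/-- Averages of points of a convex set lie in the set. [folklore: convex combinations] -/
private theorem yAvg_mem {D : Set Y} (hD : Convex ℝ D) {z : ℕ → X × Y}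
    (hz : ∀ n, (z (n + 1)).2 ∈ D) {N : ℕ} (hN : N ≠ 0) : yAvg z N ∈ D := by
  unfold yAvg
  rw [Finset.smul_sum]
  refine hD.sum_mem (fun _ _ => by positivity) ?_ (fun n _ => hz n)
  rw [Finset.sum_const, Finset.card_range, nsmul_eq_mul,
    mul_inv_cancel₀ (Nat.cast_ne_zero.mpr hN)]

/-- **The gap sandwich at a saddle point.** For the projection-form iteration (whose iterates stay in
`C × D`), step sizes `τ, σ > 0` with `τσ‖K‖² ≤ 1`, a saddle point `z* = (x*, y*)` and `N ≥ 1`: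
`0 ≤ L(X_N, y*) − L(x*, Y_N) ≤ ‖z⁰ − z*‖²_M / (2N)`.
[cite: ChambollePock2015, Theorem 1 (14) and Remark 3 («L(X^N, y*) − L(x*, Y^N) ≥ 0»)] -/
theorem conicL_gap_ergodic_saddle (K : X →L[ℝ] Y) {C : Set X} {D : Set Y} (hCne : C.Nonempty)
    (hCcl : IsClosed C) (hCc : Convex ℝ C) (hDne : D.Nonempty) (hDcl : IsClosed D)
    (hDc : Convex ℝ D) (c : X) (b : Y) {τ σ : ℝ} (hτ : 0 < τ) (hσ : 0 < σ)
    (hK : τ * σ * ‖K‖ ^ 2 ≤ 1) {xs : X} {ys : Y}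
    (hs : WithLp.toLp 2 (xs, ys) ∈ zer (kkt K (shiftOp c (normalCone C)) (shiftOp b (normalCone D))))
    (z₀ : X × Y) {N : ℕ} (hN : N ≠ 0) :
    0 ≤ conicL K c b
          (xAvg (pdhgIter K τ σ (fun z => proj C (z - τ • c)) (fun z => proj D (z - σ • b)) z₀) N) ys -
        conicL K c b xs
          (yAvg (pdhgIter K τ σ (fun z => proj C (z - τ • c)) (fun z => proj D (z - σ • b)) z₀) N) ∧
      conicL K c b
          (xAvg (pdhgIter K τ σ (fun z => proj C (z - τ • c)) (fun z => proj D (z - σ • b)) z₀) N) ys -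
        conicL K c b xs
          (yAvg (pdhgIter K τ σ (fun z => proj C (z - τ • c)) (fun z => proj D (z - σ • b)) z₀) N) ≤
      (N : ℝ)⁻¹ * (2⁻¹ * ⟪WithLp.toLp 2 z₀ - WithLp.toLp 2 (xs, ys),
        metricM K τ σ (WithLp.toLp 2 z₀ - WithLp.toLp 2 (xs, ys))⟫) := by
  set z := pdhgIter K τ σ (fun z => proj C (z - τ • c)) (fun z => proj D (z - σ • b)) z₀ with hz
  obtain ⟨hxs, hys, hmin, hmax⟩ := (mem_zer_kkt_conic_iff_saddle K C D c b xs ys).mp hs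
  have hzC : ∀ n, (z (n + 1)).1 ∈ C := fun n => proj_mem hCne hCcl.isComplete hCc _
  have hzD : ∀ n, (z (n + 1)).2 ∈ D := fun n => proj_mem hDne hDcl.isComplete hDc _
  refine ⟨?_, conicL_gap_ergodic_le K c b hτ hσ hK
    (isResolventMap_shiftOp (isResolventMap_proj hCne hCcl.isComplete hCc hτ))
    (isResolventMap_shiftOp (isResolventMap_proj hDne hDcl.isComplete hDc hσ)) z₀ hxs hys hN⟩
  have h1 := hmin _ (xAvg_mem hCc hzC hN)
  have h2 := hmax _ (yAvg_mem hDc hzD hN)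
  linarith

/-- **Projection-form PDHG on compact sets converges, with no existence hypothesis.** `X`, `Y`
finite-dimensional, `C`, `D` nonempty compact convex, `τ, σ > 0`, `τσ‖K‖² < 1`: the iterates converge
to a saddle point of the conic Lagrangian (existence by `zer_kkt_conic_nonempty_of_isCompact`).
[cite: ChambollePock2010, Thm 1 (c)] [cite: Aubin1993, Thm 8.2 (existence of the saddle point)] -/
theorem tendsto_pdhgIter_conic_of_isCompact [FiniteDimensional ℝ X] [FiniteDimensional ℝ Y]
    (K : X →L[ℝ] Y) {C : Set X} {D : Set Y} (hCne : C.Nonempty) (hCc : IsCompact C)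
    (hCconv : Convex ℝ C) (hDne : D.Nonempty) (hDc : IsCompact D) (hDconv : Convex ℝ D) (c : X)
    (b : Y) {τ σ : ℝ} (hτ : 0 < τ) (hσ : 0 < σ) (hK : τ * σ * ‖K‖ ^ 2 < 1) (z₀ : X × Y) :
    ∃ zs : X × Y, WithLp.toLp 2 zs ∈ zer (kkt K (shiftOp c (normalCone C)) (shiftOp b (normalCone D))) ∧
      Filter.Tendsto
        (pdhgIter K τ σ (fun z => proj C (z - τ • c)) (fun z => proj D (z - σ • b)) z₀)
        Filter.atTop (nhds zs) :=
  tendsto_pdhgIter_conic K hCne hCc.isClosed hCconv hDne hDc.isClosed hDconv c b hτ hσ hK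
    (zer_kkt_conic_nonempty_of_isCompact K hCne hCc hCconv hDne hDc hDconv c b) z₀

/-! #### Limits of the ergodic (averaged) sequence are saddle points (Chambolle–Pock 2016, Remark 3
and the paragraph after it) -/

/-- **Subsequential limits of the averaged iterates are saddle points** [ChambollePock2015, Remark 3:
«from (14) … it follows that the limit Z is a saddle-point»], here for the constrained bilinear case
and subsequences in norm: if along indices `φ k → ∞` the averages `(X_{φ_k+1}, Y_{φ_k+1})` of the
PDHG iterates (resolvent maps of `c + N_C`, `b + N_D`, `τ, σ > 0`, `τσ‖K‖² ≤ 1`) converge to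
`(x̄, ȳ)`, and the averages lie in the closed sets `C`, `D`, then `(x̄, ȳ)` is a saddle point — by the
ergodic bound (14) and continuity of `L`. [cite: ChambollePock2015, Remark 3] -/
theorem mem_zer_kkt_conic_of_tendsto_avg (K : X →L[ℝ] Y) {C : Set X} {D : Set Y}
    (hCcl : IsClosed C) (hDcl : IsClosed D) (c : X) (b : Y) {τ σ : ℝ} (hτ : 0 < τ) (hσ : 0 < σ)
    (hK : τ * σ * ‖K‖ ^ 2 ≤ 1) {jA : X → X} {jB : Y → Y}
    (hjA : IsResolventMap τ (shiftOp c (normalCone C)) jA)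
    (hjB : IsResolventMap σ (shiftOp b (normalCone D)) jB) (z₀ : X × Y)
    (hzC : ∀ N, N ≠ 0 → xAvg (pdhgIter K τ σ jA jB z₀) N ∈ C)
    (hzD : ∀ N, N ≠ 0 → yAvg (pdhgIter K τ σ jA jB z₀) N ∈ D) {φ : ℕ → ℕ}
    (hφ : Filter.Tendsto φ Filter.atTop Filter.atTop) {xl : X} {yl : Y}
    (hx : Filter.Tendsto (fun k => xAvg (pdhgIter K τ σ jA jB z₀) (φ k + 1)) Filter.atTop (nhds xl))
    (hy : Filter.Tendsto (fun k => yAvg (pdhgIter K τ σ jA jB z₀) (φ k + 1)) Filter.atTop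
      (nhds yl)) :
    WithLp.toLp 2 (xl, yl) ∈ zer (kkt K (shiftOp c (normalCone C)) (shiftOp b (normalCone D))) := by
  set z := pdhgIter K τ σ jA jB z₀ with hz
  have hxl : xl ∈ C :=
    hCcl.mem_of_tendsto hx (Filter.Eventually.of_forall fun k => hzC _ (Nat.succ_ne_zero _))
  have hyl : yl ∈ D :=
    hDcl.mem_of_tendsto hy (Filter.Eventually.of_forall fun k => hzD _ (Nat.succ_ne_zero _))
  -- the gap against any fixed `(ξ, η) ∈ C × D` is `≤ 0` in the limit
  have hgap : ∀ ξ ∈ C, ∀ η ∈ D, conicL K c b xl η - conicL K c b ξ yl ≤ 0 := by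
    intro ξ hξ η hη
    set c₀ := 2⁻¹ * ⟪WithLp.toLp 2 z₀ - WithLp.toLp 2 (ξ, η),
        metricM K τ σ (WithLp.toLp 2 z₀ - WithLp.toLp 2 (ξ, η))⟫ with hc₀
    have hle : ∀ k, conicL K c b (xAvg z (φ k + 1)) η - conicL K c b ξ (yAvg z (φ k + 1)) ≤
        ((φ k + 1 : ℕ) : ℝ)⁻¹ * c₀ := fun k =>
      conicL_gap_ergodic_le K c b hτ hσ hK hjA hjB z₀ hξ hη (Nat.succ_ne_zero _)
    have hlim1 : Filter.Tendsto
        (fun k => conicL K c b (xAvg z (φ k + 1)) η - conicL K c b ξ (yAvg z (φ k + 1)))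
        Filter.atTop (nhds (conicL K c b xl η - conicL K c b ξ yl)) :=
      (((continuous_conicL_left K c b η).tendsto xl).comp hx).sub
        (((continuous_conicL_right K c b ξ).tendsto yl).comp hy)
    have hlim2 : Filter.Tendsto (fun k => ((φ k + 1 : ℕ) : ℝ)⁻¹ * c₀) Filter.atTop (nhds 0) := by
      have h1 : Filter.Tendsto (fun k => φ k + 1) Filter.atTop Filter.atTop :=
        Filter.tendsto_atTop_mono (fun k => Nat.le_succ _) hφ
      have h2 : Filter.Tendsto (fun k => ((φ k + 1 : ℕ) : ℝ)⁻¹) Filter.atTop (nhds 0) :=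
        tendsto_inv_atTop_zero.comp (tendsto_natCast_atTop_atTop.comp h1)
      simpa using h2.mul_const c₀
    exact le_of_tendsto_of_tendsto hlim1 hlim2 (Filter.Eventually.of_forall hle)
  refine (mem_zer_kkt_conic_iff_saddle K C D c b xl yl).mpr ⟨hxl, hyl, fun ξ hξ => ?_, fun η hη => ?_⟩
  · linarith [hgap ξ hξ yl hyl]
  · linarith [hgap xl hxl η hη]

/-- For the projection-form iteration the averages stay in `C` (the iterates do, and `C` is convex).
[cite: ChambollePock2015, Remark 3 (the averages X^N, Y^N lie in dom g × dom h*)] -/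
theorem xAvg_pdhgIter_proj_mem (K : X →L[ℝ] Y) {C : Set X} (hCne : C.Nonempty) (hCcl : IsClosed C)
    (hCc : Convex ℝ C) (D : Set Y) (c : X) (b : Y) (τ σ : ℝ) (z₀ : X × Y) {N : ℕ} (hN : N ≠ 0) :
    xAvg (pdhgIter K τ σ (fun z => proj C (z - τ • c)) (fun z => proj D (z - σ • b)) z₀) N ∈ C :=
  xAvg_mem hCc (fun _ => proj_mem hCne hCcl.isComplete hCc _) hN

/-- For the projection-form iteration the averages stay in `D`.
[cite: ChambollePock2015, Remark 3 (the averages X^N, Y^N lie in dom g × dom h*)] -/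
theorem yAvg_pdhgIter_proj_mem (K : X →L[ℝ] Y) (C : Set X) {D : Set Y} (hDne : D.Nonempty)
    (hDcl : IsClosed D) (hDc : Convex ℝ D) (c : X) (b : Y) (τ σ : ℝ) (z₀ : X × Y) {N : ℕ}
    (hN : N ≠ 0) :
    yAvg (pdhgIter K τ σ (fun z => proj C (z - τ • c)) (fun z => proj D (z - σ • b)) z₀) N ∈ D :=
  yAvg_mem hDc (fun _ => proj_mem hDne hDcl.isComplete hDc _) hN

/-- **On compact sets some subsequence of the averaged iterates converges to a saddle point**
(projection form, `τ, σ > 0`, `τσ‖K‖² ≤ 1`; compactness gives the subsequence,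
`mem_zer_kkt_conic_of_tendsto_avg` identifies the limit). [cite: ChambollePock2015, Remark 3] -/
theorem exists_tendsto_avg_subseq_of_isCompact (K : X →L[ℝ] Y) {C : Set X} {D : Set Y}
    (hCne : C.Nonempty) (hCc : IsCompact C) (hCconv : Convex ℝ C) (hDne : D.Nonempty)
    (hDc : IsCompact D) (hDconv : Convex ℝ D) (c : X) (b : Y) {τ σ : ℝ} (hτ : 0 < τ)
    (hσ : 0 < σ) (hK : τ * σ * ‖K‖ ^ 2 ≤ 1) (z₀ : X × Y) :
    ∃ (xl : X) (yl : Y) (φ : ℕ → ℕ), StrictMono φ ∧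
      WithLp.toLp 2 (xl, yl) ∈ zer (kkt K (shiftOp c (normalCone C)) (shiftOp b (normalCone D))) ∧
      Filter.Tendsto
        (fun k => (xAvg (pdhgIter K τ σ (fun z => proj C (z - τ • c))
            (fun z => proj D (z - σ • b)) z₀) (φ k + 1),
          yAvg (pdhgIter K τ σ (fun z => proj C (z - τ • c))
            (fun z => proj D (z - σ • b)) z₀) (φ k + 1)))
        Filter.atTop (nhds (xl, yl)) := by
  set z := pdhgIter K τ σ (fun z => proj C (z - τ • c)) (fun z => proj D (z - σ • b)) z₀ with hz
  have hzC : ∀ N, N ≠ 0 → xAvg z N ∈ C := fun N hN =>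
    xAvg_pdhgIter_proj_mem K hCne hCc.isClosed hCconv D c b τ σ z₀ hN
  have hzD : ∀ N, N ≠ 0 → yAvg z N ∈ D := fun N hN =>
    yAvg_pdhgIter_proj_mem K C hDne hDc.isClosed hDconv c b τ σ z₀ hN
  have hmem : ∀ k, (xAvg z (k + 1), yAvg z (k + 1)) ∈ C ×ˢ D := fun k =>
    ⟨hzC _ (Nat.succ_ne_zero _), hzD _ (Nat.succ_ne_zero _)⟩
  obtain ⟨⟨xl, yl⟩, -, φ, hφ, hlim⟩ := (hCc.prod hDc).tendsto_subseq hmem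
  have hx : Filter.Tendsto (fun k => xAvg z (φ k + 1)) Filter.atTop (nhds xl) :=
    (continuous_fst.tendsto _).comp hlim
  have hy : Filter.Tendsto (fun k => yAvg z (φ k + 1)) Filter.atTop (nhds yl) :=
    (continuous_snd.tendsto _).comp hlim
  exact ⟨xl, yl, φ, hφ,
    mem_zer_kkt_conic_of_tendsto_avg K hCc.isClosed hDc.isClosed c b hτ hσ hK
      (isResolventMap_shiftOp (isResolventMap_proj hCne hCc.isClosed.isComplete hCconv hτ))
      (isResolventMap_shiftOp (isResolventMap_proj hDne hDc.isClosed.isComplete hDconv hσ))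
      z₀ hzC hzD hφ.tendsto_atTop hx hy, hlim⟩

omit [CompleteSpace X] [CompleteSpace Y] in
/-- **When the iterates converge, the averages converge to the same point** (Cesàro): if
`z^n → z̄` then `(X_N, Y_N) → z̄` — [ChambollePock2015, §3 after Remark 3: «convergence of the whole
sequences z^n and Z^N to the same saddle-point»]; combine with `tendsto_pdhgIter` /
`tendsto_pdhgIter_conic`. [cite: ChambollePock2015, §3 (paragraph after Remark 3)] -/
theorem tendsto_avg_of_tendsto {z : ℕ → X × Y} {zl : X × Y}
    (hz : Filter.Tendsto z Filter.atTop (nhds zl)) :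
    Filter.Tendsto (fun N => (xAvg z N, yAvg z N)) Filter.atTop (nhds zl) := by
  have h1 : Filter.Tendsto (fun n => z (n + 1)) Filter.atTop (nhds zl) :=
    hz.comp (Filter.tendsto_add_atTop_nat 1)
  have hx : Filter.Tendsto (fun N => xAvg z N) Filter.atTop (nhds zl.1) :=
    ((continuous_fst.tendsto _).comp h1).cesaro_smul
  have hy : Filter.Tendsto (fun N => yAvg z N) Filter.atTop (nhds zl.2) :=
    ((continuous_snd.tendsto _).comp h1).cesaro_smul
  rw [← Prod.mk.eta (p := zl)]
  exact hx.prodMk_nhds hy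

end Conic

/-! ### The fixed-point residual in the metric `M`: monotone and `O(1/k)` (Davis–Yin 2016, Theorem 1,
for the proximal-point form (12)) -/

section Residual

/-- `M ⪰ 0` when `τσ‖K‖² ≤ 1`: `⟨d, M d⟩ ≥ 0`. [cite: ChambollePock2015, §3 (after (12)) and Remark 3 (20)] -/
theorem inner_metricM_self_nonneg (K : X →L[ℝ] Y) {τ σ : ℝ} (hτ : 0 < τ) (hσ : 0 < σ)
    (hK : τ * σ * ‖K‖ ^ 2 ≤ 1) (d : WithLp 2 (X × Y)) : 0 ≤ ⟪d, metricM K τ σ d⟫ := by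
  have h := inner_metricM_self_ge K hτ hσ d
  have hcoef : 0 ≤ 1 - Real.sqrt (τ * σ) * ‖K‖ := by
    have h0 : 0 ≤ Real.sqrt (τ * σ) * ‖K‖ := by positivity
    have h1 : (Real.sqrt (τ * σ) * ‖K‖) ^ 2 ≤ 1 := by
      rw [mul_pow, Real.sq_sqrt (by positivity)]; exact hK
    nlinarith
  exact (mul_nonneg hcoef (by positivity)).trans h

/-- **The `M`-residual is non-increasing along PDHG**: with `d^k = z^k − z^{k+1}`,
`‖d^{k+1}‖²_M ≤ ‖d^k‖²_M` (`τ, σ > 0`, `τσ‖K‖² ≤ 1`, `A`, `B` monotone with resolvent maps).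
Mechanism: by (12), `M d^k ∈ F(z^{k+1})` and `M d^{k+1} ∈ F(z^{k+2})`; monotonicity of `F` gives
`⟨d^{k+1}, M d^k⟩ ≥ ‖d^{k+1}‖²_M`, and `‖d^k − d^{k+1}‖²_M ≥ 0` finishes. This is
[DavisYin2016, Thm 1 (2)] for the PPA form of PDHG (`λ_k ≡ ½`: the step is the `½`-average of its
reflection in the `M`-geometry). [cite: DavisYin2016, Theorem 1 (2)] [cite: ChambollePock2015, §3 (12)] -/
theorem residual_antitone (K : X →L[ℝ] Y) {A : Set (X × X)} {B : Set (Y × Y)} {τ σ : ℝ}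
    (hτ : 0 < τ) (hσ : 0 < σ) (hK : τ * σ * ‖K‖ ^ 2 ≤ 1) (hA : IsMonotone A) (hB : IsMonotone B)
    {jA : X → X} {jB : Y → Y} (hjA : IsResolventMap τ A jA) (hjB : IsResolventMap σ B jB)
    (z₀ : X × Y) :
    Antitone fun k =>
      ⟪WithLp.toLp 2 (pdhgIter K τ σ jA jB z₀ k) - WithLp.toLp 2 (pdhgIter K τ σ jA jB z₀ (k + 1)),
        metricM K τ σ (WithLp.toLp 2 (pdhgIter K τ σ jA jB z₀ k) -
          WithLp.toLp 2 (pdhgIter K τ σ jA jB z₀ (k + 1)))⟫ := by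
  refine antitone_nat_of_succ_le fun k => ?_
  set z : ℕ → WithLp 2 (X × Y) := fun k => WithLp.toLp 2 (pdhgIter K τ σ jA jB z₀ k) with hz
  have hzs : ∀ k, pdhgIter K τ σ jA jB z₀ (k + 1) = pdhgStep K τ σ jA jB (pdhgIter K τ σ jA jB z₀ k) :=
    fun k => rfl
  -- the two inclusions (12)
  have h1 : (z (k + 1), metricM K τ σ (z k - z (k + 1))) ∈ kkt K A B := by
    simp only [hz, hzs k]
    exact pdhgStep_mem_kkt K hτ.ne' hσ.ne' hjA hjB _
  have h2 : (z (k + 2), metricM K τ σ (z (k + 1) - z (k + 2))) ∈ kkt K A B := by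
    simp only [hz, hzs (k + 1)]
    exact pdhgStep_mem_kkt K hτ.ne' hσ.ne' hjA hjB _
  set d0 := z k - z (k + 1) with hd0
  set d1 := z (k + 1) - z (k + 2) with hd1
  -- monotonicity of `F`
  have hmono := isMonotone_kkt K hA hB h1 h2
  have e1 : z (k + 2) - z (k + 1) = -d1 := by rw [hd1]; abel
  rw [e1, inner_neg_left, inner_sub_right] at hmono
  have hge : ⟪d1, metricM K τ σ d1⟫ ≤ ⟪d1, metricM K τ σ d0⟫ := by linarith
  -- `‖d0 − d1‖²_M ≥ 0`
  have hnn := inner_metricM_self_nonneg K hτ hσ hK (d0 - d1)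
  have hexp : ⟪d0 - d1, metricM K τ σ (d0 - d1)⟫ =
      ⟪d0, metricM K τ σ d0⟫ - 2 * ⟪d1, metricM K τ σ d0⟫ + ⟪d1, metricM K τ σ d1⟫ := by
    have h := inner_metricM_self_add K τ σ (d0 - d1) d1
    rw [sub_add_cancel] at h
    have h' : ⟪d0 - d1, metricM K τ σ d1⟫ = ⟪d0, metricM K τ σ d1⟫ - ⟪d1, metricM K τ σ d1⟫ :=
      inner_sub_left _ _ _
    have hc : ⟪d0, metricM K τ σ d1⟫ = ⟪d1, metricM K τ σ d0⟫ := by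
      rw [inner_metricM_comm, real_inner_comm]
    linarith
  show ⟪d1, metricM K τ σ d1⟫ ≤ ⟪d0, metricM K τ σ d0⟫
  linarith

/-- **Summability of the `M`-residuals** (from the Fejér inequality): for every saddle point `z*`,
`Σ_{k<N} ‖z^k − z^{k+1}‖²_M ≤ ‖z⁰ − z*‖²_M`. [cite: DavisYin2016, Theorem 1 (3)] [cite: ChambollePock2015, §3 (15)] -/
theorem sum_residual_le (K : X →L[ℝ] Y) {A : Set (X × X)} {B : Set (Y × Y)} {τ σ : ℝ}
    (hτ : 0 < τ) (hσ : 0 < σ) (hK : τ * σ * ‖K‖ ^ 2 ≤ 1) (hA : IsMonotone A) (hB : IsMonotone B)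
    {jA : X → X} {jB : Y → Y} (hjA : IsResolventMap τ A jA) (hjB : IsResolventMap σ B jB)
    {zs : WithLp 2 (X × Y)} (hzs : zs ∈ zer (kkt K A B)) (z₀ : X × Y) (N : ℕ) :
    ∑ k ∈ Finset.range N,
        ⟪WithLp.toLp 2 (pdhgIter K τ σ jA jB z₀ k) - WithLp.toLp 2 (pdhgIter K τ σ jA jB z₀ (k + 1)),
          metricM K τ σ (WithLp.toLp 2 (pdhgIter K τ σ jA jB z₀ k) -
            WithLp.toLp 2 (pdhgIter K τ σ jA jB z₀ (k + 1)))⟫ ≤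
      ⟪WithLp.toLp 2 z₀ - zs, metricM K τ σ (WithLp.toLp 2 z₀ - zs)⟫ := by
  set z : ℕ → WithLp 2 (X × Y) := fun k => WithLp.toLp 2 (pdhgIter K τ σ jA jB z₀ k) with hz
  let q : WithLp 2 (X × Y) → ℝ := fun d => ⟪d, metricM K τ σ d⟫
  have hstep : ∀ k, q (z (k + 1) - zs) + q (z k - z (k + 1)) ≤ q (z k - zs) := fun k =>
    fejer_step K hτ hσ hA hB hjA hjB hzs (pdhgIter K τ σ jA jB z₀ k)
  have htel : ∀ N, ∑ k ∈ Finset.range N, q (z k - z (k + 1)) ≤ q (z 0 - zs) - q (z N - zs) := by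
    intro N
    induction N with
    | zero => simp
    | succ N ih =>
        rw [Finset.sum_range_succ]
        linarith [hstep N]
  have hnn := inner_metricM_self_nonneg K hτ hσ hK (z N - zs)
  have h := htel N
  have hz0 : z 0 = WithLp.toLp 2 z₀ := rfl
  rw [hz0] at h
  change ∑ k ∈ Finset.range N, q (z k - z (k + 1)) ≤ q (WithLp.toLp 2 z₀ - zs)
  change 0 ≤ q (z N - zs) at hnn
  linarith

/-- **Non-ergodic `O(1/k)` rate of the `M`-residual**: for every saddle point `z*` and `N`,
`‖z^N − z^{N+1}‖²_M ≤ ‖z⁰ − z*‖²_M / (N + 1)` — monotone + summable. This is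
[DavisYin2016, Thm 1 (4)] with `λ_k ≡ ½`, `τ_k ≡ ¼`, `‖Tz^k − z^k‖ = 2‖z^k − z^{k+1}‖`, read in the
`M`-geometry of the PPA form (12). [cite: DavisYin2016, Theorem 1 (4)] [cite: ChambollePock2015, §3 (12), (15)] -/
theorem residual_le_div (K : X →L[ℝ] Y) {A : Set (X × X)} {B : Set (Y × Y)} {τ σ : ℝ}
    (hτ : 0 < τ) (hσ : 0 < σ) (hK : τ * σ * ‖K‖ ^ 2 ≤ 1) (hA : IsMonotone A) (hB : IsMonotone B)
    {jA : X → X} {jB : Y → Y} (hjA : IsResolventMap τ A jA) (hjB : IsResolventMap σ B jB)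
    {zs : WithLp 2 (X × Y)} (hzs : zs ∈ zer (kkt K A B)) (z₀ : X × Y) (N : ℕ) :
    ⟪WithLp.toLp 2 (pdhgIter K τ σ jA jB z₀ N) - WithLp.toLp 2 (pdhgIter K τ σ jA jB z₀ (N + 1)),
        metricM K τ σ (WithLp.toLp 2 (pdhgIter K τ σ jA jB z₀ N) -
          WithLp.toLp 2 (pdhgIter K τ σ jA jB z₀ (N + 1)))⟫ ≤
      ⟪WithLp.toLp 2 z₀ - zs, metricM K τ σ (WithLp.toLp 2 z₀ - zs)⟫ / (N + 1) := by
  set r : ℕ → ℝ := fun k =>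
    ⟪WithLp.toLp 2 (pdhgIter K τ σ jA jB z₀ k) - WithLp.toLp 2 (pdhgIter K τ σ jA jB z₀ (k + 1)),
      metricM K τ σ (WithLp.toLp 2 (pdhgIter K τ σ jA jB z₀ k) -
        WithLp.toLp 2 (pdhgIter K τ σ jA jB z₀ (k + 1)))⟫ with hr
  have hanti : Antitone r := residual_antitone K hτ hσ hK hA hB hjA hjB z₀
  have hsum := sum_residual_le K hτ hσ hK hA hB hjA hjB hzs z₀ (N + 1)
  have hlow : ((N : ℝ) + 1) * r N ≤ ∑ k ∈ Finset.range (N + 1), r k := by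
    have h : ∑ k ∈ Finset.range (N + 1), r N ≤ ∑ k ∈ Finset.range (N + 1), r k :=
      Finset.sum_le_sum fun k hk => hanti (Nat.lt_succ_iff.mp (Finset.mem_range.mp hk))
    rw [Finset.sum_const, Finset.card_range, nsmul_eq_mul] at h
    push_cast at h
    exact h
  have hN : (0 : ℝ) < N + 1 := by positivity
  change r N ≤ _ / (N + 1)
  rw [le_div_iff₀ hN]
  linarith

/-- **Little-`o` rate of the `M`-residual**: `k · ‖z^k − z^{k+1}‖²_M → 0` — monotone and summable
sequences are `o(1/k)` ([DavisYin2016, Lemma 3 (1)], used through the tree's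
`FixedPointResidualRates.tendsto_window_mul`). This is the `o(1/(k+1))` clause of
[DavisYin2016, Thm 1 (4)] for the PPA form of PDHG. [cite: DavisYin2016, Theorem 1 (4) (little-o) and Lemma 3 (1)] -/
theorem tendsto_mul_residual (K : X →L[ℝ] Y) {A : Set (X × X)} {B : Set (Y × Y)} {τ σ : ℝ}
    (hτ : 0 < τ) (hσ : 0 < σ) (hK : τ * σ * ‖K‖ ^ 2 ≤ 1) (hA : IsMonotone A) (hB : IsMonotone B)
    {jA : X → X} {jB : Y → Y} (hjA : IsResolventMap τ A jA) (hjB : IsResolventMap σ B jB)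
    (hsad : (zer (kkt K A B)).Nonempty) (z₀ : X × Y) :
    Filter.Tendsto (fun k : ℕ => (k : ℝ) *
      ⟪WithLp.toLp 2 (pdhgIter K τ σ jA jB z₀ k) - WithLp.toLp 2 (pdhgIter K τ σ jA jB z₀ (k + 1)),
        metricM K τ σ (WithLp.toLp 2 (pdhgIter K τ σ jA jB z₀ k) -
          WithLp.toLp 2 (pdhgIter K τ σ jA jB z₀ (k + 1)))⟫) Filter.atTop (nhds 0) := by
  obtain ⟨zs, hzs⟩ := hsad
  set r : ℕ → ℝ := fun k =>
    ⟪WithLp.toLp 2 (pdhgIter K τ σ jA jB z₀ k) - WithLp.toLp 2 (pdhgIter K τ σ jA jB z₀ (k + 1)),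
      metricM K τ σ (WithLp.toLp 2 (pdhgIter K τ σ jA jB z₀ k) -
        WithLp.toLp 2 (pdhgIter K τ σ jA jB z₀ (k + 1)))⟫ with hr
  have hr0 : ∀ k, 0 ≤ r k := fun k => inner_metricM_self_nonneg K hτ hσ hK _
  have hanti : Antitone r := residual_antitone K hτ hσ hK hA hB hjA hjB z₀
  have hsumm : Summable r :=
    summable_of_sum_range_le hr0 (fun N => sum_residual_le K hτ hσ hK hA hB hjA hjB hzs z₀ N)
  -- the tree's window lemma with `λ ≡ 1`
  have hwin := Literature.Analysis.Convex.FixedPointResidualRates.tendsto_window_mul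
    (lam := fun _ => (1 : ℝ)) (a := r) (fun _ => zero_le_one) hr0 hanti (by simpa using hsumm)
  have hcard : ∀ k : ℕ, (∑ i ∈ Finset.Ico ((k + 1) / 2 + 1) (k + 1), (1 : ℝ)) =
      ((k + 1 - ((k + 1) / 2 + 1) : ℕ) : ℝ) := fun k => by
    rw [Finset.sum_const, Nat.card_Ico, nsmul_eq_mul, mul_one]
  simp only [hcard] at hwin
  have hlim0 : Filter.Tendsto r Filter.atTop (nhds 0) := hsumm.tendsto_atTop_zero
  -- squeeze: `k · r_k ≤ 2 · (window · r_k) + r_k`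
  have hup : Filter.Tendsto (fun k : ℕ => 2 * (((k + 1 - ((k + 1) / 2 + 1) : ℕ) : ℝ) * r k) + r k)
      Filter.atTop (nhds 0) := by
    simpa using (hwin.const_mul 2).add hlim0
  refine tendsto_of_tendsto_of_tendsto_of_le_of_le tendsto_const_nhds hup
    (fun k => mul_nonneg (Nat.cast_nonneg k) (hr0 k)) fun k => ?_
  have hk : (k : ℝ) ≤ 2 * ((k + 1 - ((k + 1) / 2 + 1) : ℕ) : ℝ) + 1 := by
    have h : k ≤ 2 * (k + 1 - ((k + 1) / 2 + 1)) + 1 := by omega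
    exact_mod_cast h
  have := hr0 k
  nlinarith

end Residual

end Literature.Analysis.Convex.PrimalDualHybridGradient
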